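import Summits.AtomisticToContinuum.HydrodynamicLimit.Theses.AntiMazurCoboundaries
import Literature.MathematicalPhysics.KineticTheory.HardSphereEulerProofs
import Literature.Analysis.FluidPDE.HardSphereAlexander
import Literature.Analysis.FluidPDE.HardSphereTorusMeasure

/-!
# Disproof of `InfluenceLocality` (stmt-AtomisticToContinuum-13916) — standing crux disprover

Work file of refuter-cdisprove-stmt-AtomisticToContinuum-13916-0 (cycle 1, 2026-08-16). Builds
on, and does not repeat, refuter-rattack-13916-0's `ANALYSIS.md` / `Evidence.lean`
(`weak_regime`, `flows_inhabited`, `gibbs_isProbability`) and refuter g47-2's check note (both on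
the item). Everything outside `§(E)` is sorry-free; `§(E)` holds the ONE remaining near-miss,
the static equilibrium estimate `servedSphere_mass`, to which BOTH load-bearing claims are
reduced by §F (certification) and §G (matching + reverse Markov).

## Findings

1. NO KILL. The crux is, by `Iff.rfl`, a readable quantifier shell around `Bound`
   (`influenceLocality_iff`); its junk conventions are `G_N`-null (flow values off good sets,
   frozen forecasts off the cluster flow's good set; the `∫⁻` of the possibly non-measurable
   integrand is a LOWER integral, which only weakens the claim); the interface is inhabited
   non-trivially (`HardSphereFlow.nonempty_torus_holds` — Alexander's theorem is PROVED in the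
   tree) and cannot be gamed (`flow_eq_ae_holds`: two flows agree Liouville-a.e., so `∀ Ψ` is the
   physical cluster dynamics). The LD cost table below finds no mechanism producing a bad FRACTION
   at a cost per bad particle bounded in `R`; the statement is very probably TRUE in its
   exponential-moment form — but only with `R` EXPONENTIAL in `lam` (item 4).
2. LOAD-BEARING HYPOTHESES. `0 < δ`: the no-slack version `WithoutDelta` is false modulo the
   dynamical fact `CorruptionEvent` (`withoutDelta_false_of_corruption`). The ORDER `lam` before
   `R`: `UniformInLam` (`∃ R ∀ lam`) is false modulo `PositiveBadFraction` (a bad fraction `ε`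
   with probability `≥ q > 0`; `uniformInLam_false_of_positiveBadFraction`; the stronger
   `TypicalBadFraction` version is kept). BOTH dynamical facts are PROVED modulo ONE static
   estimate `ServedSphereMass` (§G, `corruptionEvent_of_servedSphereMass`,
   `positiveBadFraction_of_servedSphereMass`): explicit Alexander flows (§F `alexanderFlow`), the
   certification lemma "two isolated spheres whose free flights overlap ⇒ one of THEM is bad"
   (`mem_badSet_or_of_isolated_overlap`, no computation of the dynamics), the matching lemma
   `#served ≤ #bad` (slow isolated spheres are never partners and never share one), and a
   reverse-Markov inequality. So `not_withoutDelta` and `not_uniformInLam` hang on the single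
   `sorry` `servedSphere_mass` — pure equilibrium statistical mechanics. `σ < σ₀`: used only through `σ ≤ 1/2`
   (probability of `G_N`, existence of the torus flow). DECORATION: `0 < T` (`bound_of_T_neg`;
   `T = 0` is a.e.-trivial), `lam ≤ δ` incl. `lam ≤ 0` (`bound_of_lam_le_delta`, ANY `R`),
   `0 < a` (cancels in the canonical density), `u₀` (Galilean covariance of the torus dynamics,
   clusters are selected at time `0`), `θ` (only `T√θ` matters).
3. KILL CRITERION (`not_influenceLocality_of_witness`, proved): to refute, exhibit for EVERY `R`
   measurable events `A_N` with `#bad ≥ m` on `A_N` and `G_N(A_N) > e^{δ(N+1) − lam·m}`.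
4. TIGHTNESS AND A CORRECTION TO THE ROUTE'S PICTURE (paper; constants order-of-magnitude).
   (a) RELAY CHAINS. A truth-vs-forecast discrepancy needs NO carrier across the distance:
   take successive pairs `(p_{k-1}, p_k)` whose FREE FLIGHTS are scheduled to collide once
   each, at increasing times `t_1 < ⋯ < t_n ≤ T` (gaps up to `≈ v̄T` each, directions biased
   outward). Undisturbed, the row fires alternately (`p_0` hits `p_1` at `t_1`; deflected `p_1`
   misses `p_2`; pristine `p_2` hits `p_3` at `t_3`; …), a parity pattern anchored at its first
   sphere. The forecast of `p_k` truncates the row at `∂B(x_k, Rℓ)`, re-anchoring the parity at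
   the first INCLUDED sphere `p_b`; whenever `b` is odd the two patterns are opposite at `p_k`,
   so `p_k` is bad — for every second `k` beyond `R/(σ + ḡ)` links. The discrepancy therefore
   sits at distance `n(σ + v̄T)` after time `T` with thermal speeds only (the runners start
   before the baton arrives): the route's "reach within Tℓ ≤ (chain kinetic energy)^{1/2}·Tℓ"
   and rattack's "≤ v_max·T + σ·#links" are both FALSE for forecast discrepancies; only
   `#links ≳ R/(σ + v̄T)` is forced. (b) COST. An equilibrium sphere has scheduled pair meetings
   at rate `ν = 1/t_mf`, so ordered chains of `n` links from a given sphere number `≈ Kⁿ/n!`,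
   `K = T/t_mf` (Lanford's count): the price per link is the time-ORDERING entropy
   `log(n/(eK))` plus `O(1 + K)` (outward bias, no third-party hits) — nothing else. Cost per bad
   particle: relay rows `c(R) ≈ 2·log(R/(σ + v̄T)) + O(1 + K)`; near-jammed blobs (gaps
   `σT/(2R)`, front speed `σv̄/gap`, every blob sphere bad) `≈ 3·log(R/(σT)) + O(1)`; lone
   intruders / hot spots `≍ (R/T)²`. All unbounded — no counterexample — but only
   logarithmically, which forces `R(T, lam, δ) ≳ (σ + v̄T)·exp(lam/2 − O(1 + T/t_mf))`. Hence
   any argument yielding `R` polynomial in `lam` — in particular the route's plan "sup-speed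
   tail + packing, cost per bad particle ≍ R/(2θT⁴)" — passes through a FALSE intermediate; the
   real content is an exponential-moment bound, uniform in `N` at FIXED density, on long
   TIME-ORDERED chains of successive scheduled pair collisions in either dynamics (Lanford-type
   `(CK)ⁿ/n!`; in print only for `T ≲ t_mf/5` and in the Boltzmann–Grad limit).
5. SHAPE NOTE (planner; prover of stmt-13917). Badness is NOT monotone in `R` (§D: three-sphere
   witness), so the `∃ R` this crux provides cannot be enlarged by its consumer, while
   LocalCertificateTransfer's plan takes `R ≥ max(R₀(T), R_loc(T+λ, lam, δ))`. The shape actually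
   consumed is `InfluenceLocalityEventually` (`∃ R₀ ∀ R ≥ R₀`, §D), which implies the crux
   (`influenceLocality_of_eventually`) and is heuristically equally true. Recommend re-typing.

## Numerics (kit job j009377, 2026-08-16; `mdjob/main.py`, event-driven MD, first moment only)

ℓ-units, density 1, θ = 1, σ = 0.25 (t_mf ≈ 2.26, v̄ ≈ 1.60), periodic cube n = 729 (L = 9),
16 Gibbs samples per horizon; sphere i BAD iff truth ≠ forecast from B(x_i, R) at one of 8
check times. p_bad = E#bad/n (± s.e.m. ≈ 0.005):
* T = 1 (0.47 collisions/sphere, 37 % collide): R = 1, 1.5, 2, 2.5, 3, 3.5 ↦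
  p_bad = 0.254, 0.182, 0.117, 0.069, 0.034, 0.017 (halves every ΔR ≈ 0.55 beyond R ≈ 2);
* T = 2 (0.89 collisions/sphere, 58 % collide): p_bad = 0.514, 0.466, 0.420, 0.363, 0.307, 0.254 —
  at R = 3.5 still 44 % of the colliding spheres are bad: the first-moment locality scale is
  R*(T) ≈ |v_rel|_tail·T + chain corrections ≈ 2v̄T–3v̄T, i.e. clusters of 10³–10⁴ spheres
  already at T = 2 ≈ 0.9 t_mf; the route's kinetic windows (T = s·t₀, t₀ = σ⁻² = 16 here) need
  R ≳ 10², clusters ≳ 10⁶ spheres, before E#bad/(N+1) is small — finite, but worth knowing for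
  13917 / BoltzmannGreenKubo;
* every bad sphere collided in truth (p_bad ≤ frac_collided, as it must); the sample-to-sample
  variance of #bad is 1.3–2.1 × binomial (badness comes in collision pairs) — CLT-level
  correlation only, nothing anomalous; LD tails are of course invisible to sampling.
Raw: `~/compute/j009377/outputs/results.json` (attached to the item by the compute daemon).

## LD cost table (heuristic; ℓ-units: density 1, diameter σ ≪ 1, θ = 1, horizon T, R ≫ 1 + T)

"cost" = −log G_N-probability per corrupted forecast when a bad FRACTION is produced by copies of
the mechanism (the number `lam` is compared with); constants are order-of-magnitude only:
* lone intruder from outside `B(x_i, R)` hitting `i`: `≈ R²/(2T²)` per `≤ 1 + πσ²R` bad;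
* blast wave / hot spot (Sedov radius `(E T²)^{1/5} ≥ R`): `≈ R²/T²`;
* near-jammed blob, gaps `σT/(2R)`, front speed `σv̄/gap`: `≈ 3·log(R/(σT)) + O(1)`;
* RELAY ROW of `n ≳ R/(σ + v̄T)` pre-scheduled successive pair collisions (item 4):
  `≈ 2·log(R/(σ + v̄T)) + O(1 + T/t_mf)`  ← cheapest found for large `R`.
Nothing found with cost bounded in `R`; the margin is logarithmic (time-ordering entropy only).
-/

namespace Summit.AtomisticToContinuum.HydrodynamicLimit.Cruxes.InfluenceLocality.Disproof

open MeasureTheory Set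
open scoped Classical ENNReal
open Literature.Analysis.FluidPDE Literature.MathematicalPhysics.KineticTheory
open Summit.AtomisticToContinuum.HydrodynamicLimit.Theses.AntiMazurCoboundaries (InfluenceLocality)

noncomputable section

/-- The microscopic length unit `ℓ_N = (N+1)^{-1/3}` (mean interparticle distance on the unit
torus with `N + 1` particles). -/
abbrev ell (N : ℕ) : ℝ := ((N + 1 : ℕ) : ℝ) ^ (-(1 / 3 : ℝ))

/-- The flows of the crux: a hard-sphere flow of `N + 1` spheres of diameter `σ ℓ_N` on `𝕋³`. -/
abbrev Flow (σ : ℝ) (N : ℕ) : Type :=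
  HardSphereFlow (Torus.geometry (Fin 3)) (hsDiameter σ N) (N + 1)

/-- The cluster-flow families of the crux (same diameter, every particle number). -/
abbrev ClusterFlows (σ : ℝ) (N : ℕ) : Type :=
  (k : ℕ) → HardSphereFlow (Torus.geometry (Fin 3)) (hsDiameter σ N) k

/-- `#bad`: the number of particles whose true state differs from their range-`Rℓ` local forecast
at some time of the window `[0, Tℓ]` (verbatim the `Finset.card` of the crux). -/
def badCount (σ T R : ℝ) (N : ℕ) (Φ : Flow σ N) (Ψ : ClusterFlows σ N)
    (z : Config (N + 1) (Fin 3) T3) : ℕ :=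
  (Finset.univ.filter fun i : Fin (N + 1) => ∃ t ∈ Set.Icc (0 : ℝ) (T * ell N),
      Φ.flow t z i ≠ localClusterState Ψ (R * ell N) t z i).card

/-- `G_N`: the global Gibbs law with constant profiles (verbatim the measure of the crux). -/
def gibbs (σ a θ : ℝ) (u₀ : V3) (N : ℕ) (Φ : Flow σ N) : Measure (Config (N + 1) (Fin 3) T3) :=
  localGibbsLaw σ (fun _ => a) (fun _ => u₀) (fun _ => θ) N Φ

/-- The innermost inequality of the crux at fixed parameters. -/
def Bound (a θ : ℝ) (u₀ : V3) (σ T lam δ R : ℝ) (N : ℕ) (Φ : Flow σ N) (Ψ : ClusterFlows σ N) :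
    Prop :=
  ∫⁻ z, ENNReal.ofReal (Real.exp (lam * (badCount σ T R N Φ Ψ z : ℝ))) ∂(gibbs σ a θ u₀ N Φ)
    ≤ ENNReal.ofReal (Real.exp (δ * (N + 1)))

/-- READ-BACK: the crux is, by `Iff.rfl`, the quantifier shell
`∀ a θ u₀ > 0 ∃ σ₀ ∀ σ ∈ (0, σ₀) ∀ T lam δ > 0 ∃ R > 0 ∃ N₀ ∀ N ≥ N₀ ∀ Φ ∀ Ψ` around `Bound`. -/
theorem influenceLocality_iff :
    InfluenceLocality ↔ ∀ (a θ : ℝ) (u₀ : V3), 0 < a → 0 < θ → ∃ σ₀ : ℝ, 0 < σ₀ ∧ ∀ σ : ℝ,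
      0 < σ → σ < σ₀ → ∀ (T lam δ : ℝ), 0 < T → 0 < lam → 0 < δ → ∃ R : ℝ, 0 < R ∧ ∃ N₀ : ℕ,
      ∀ N : ℕ, N₀ ≤ N → ∀ (Φ : Flow σ N) (Ψ : ClusterFlows σ N), Bound a θ u₀ σ T lam δ R N Φ Ψ :=
  Iff.rfl

/-! ## (A) Load-bearing analysis -/

/-- At most all `N + 1` spheres are bad. -/
theorem badCount_le (σ T R : ℝ) (N : ℕ) (Φ : Flow σ N) (Ψ : ClusterFlows σ N)
    (z : Config (N + 1) (Fin 3) T3) : badCount σ T R N Φ Ψ z ≤ N + 1 := by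
  unfold badCount
  calc _ ≤ Finset.univ.card := Finset.card_filter_le _ _
    _ = N + 1 := by simp

/-- `G_N` is a probability measure for `σ ≤ 1/2` (tree: `isProbabilityMeasure_localGibbsLaw`). -/
theorem isProbabilityMeasure_gibbs {σ a θ : ℝ} (u₀ : V3) (ha : 0 < a) (hθ : 0 < θ)
    (hσ : σ ≤ 1 / 2) (N : ℕ) (Φ : Flow σ N) : IsProbabilityMeasure (gibbs σ a θ u₀ N Φ) :=
  isProbabilityMeasure_localGibbsLaw continuous_const continuous_const continuous_const
    (fun _ => ha) (fun _ => hθ) hσ N Φ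

/-- WEAK REGIME `lam ≤ δ` (first proved by refuter-rattack, `Evidence.weak_regime`, re-proved
here to keep this file self-contained): the bound holds for EVERY range `R`, horizon `T`, `N`,
`Φ`, `Ψ`, because `#bad ≤ N + 1` and `G_N` is a probability measure (`σ ≤ 1/2`). All the
content of the crux is in the regime `lam > δ`. -/
theorem bound_of_lam_le_delta {σ a θ T lam δ R : ℝ} {u₀ : V3} (ha : 0 < a) (hθ : 0 < θ)
    (hσ : σ ≤ 1 / 2) (hlam : 0 ≤ lam) (h : lam ≤ δ) (N : ℕ) (Φ : Flow σ N)
    (Ψ : ClusterFlows σ N) : Bound a θ u₀ σ T lam δ R N Φ Ψ := by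
  haveI := isProbabilityMeasure_gibbs u₀ ha hθ hσ N Φ
  unfold Bound
  calc ∫⁻ z, ENNReal.ofReal (Real.exp (lam * (badCount σ T R N Φ Ψ z : ℝ))) ∂(gibbs σ a θ u₀ N Φ)
      ≤ ∫⁻ _z, ENNReal.ofReal (Real.exp (δ * (N + 1))) ∂(gibbs σ a θ u₀ N Φ) := by
        refine lintegral_mono fun z => ENNReal.ofReal_le_ofReal (Real.exp_le_exp.2 ?_)
        have h1 : (badCount σ T R N Φ Ψ z : ℝ) ≤ N + 1 := by
          exact_mod_cast badCount_le σ T R N Φ Ψ z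
        calc lam * (badCount σ T R N Φ Ψ z : ℝ) ≤ lam * (N + 1) :=
              mul_le_mul_of_nonneg_left h1 hlam
          _ ≤ δ * (N + 1) := mul_le_mul_of_nonneg_right h (by positivity)
    _ = ENNReal.ofReal (Real.exp (δ * (N + 1))) := by
        rw [lintegral_const, measure_univ, mul_one]

/-- DECORATION `0 < T`, part 1: for `T < 0` the window `[0, Tℓ]` is empty, nobody is bad. -/
theorem badCount_eq_zero_of_T_neg {σ T R : ℝ} (hT : T < 0) (N : ℕ) (Φ : Flow σ N)
    (Ψ : ClusterFlows σ N) (z : Config (N + 1) (Fin 3) T3) : badCount σ T R N Φ Ψ z = 0 := by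
  unfold badCount
  have hℓ : 0 < ell N := Real.rpow_pos_of_pos (by positivity) _
  have hneg : T * ell N < 0 := mul_neg_of_neg_of_pos hT hℓ
  simp [Set.Icc_eq_empty_of_lt hneg]

/-- DECORATION `0 < T`, part 2: for `T < 0` the bound holds for every `R`, `lam`, `δ ≥ 0`. (At
`T = 0` it also holds, `G_N`-a.e. `Φ.flow 0 z = z` and `localClusterState Ψ r 0 z i = z i`
(`HardSphereFlow.flow_zero`, `localClusterState_zero`); not formalised here: it needs the
absolute continuity of the push-forwards of `G_N` under the cluster restrictions.) -/
theorem bound_of_T_neg {σ a θ T lam δ R : ℝ} {u₀ : V3} (ha : 0 < a) (hθ : 0 < θ)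
    (hσ : σ ≤ 1 / 2) (hT : T < 0) (hδ : 0 ≤ δ) (N : ℕ) (Φ : Flow σ N) (Ψ : ClusterFlows σ N) :
    Bound a θ u₀ σ T lam δ R N Φ Ψ := by
  haveI := isProbabilityMeasure_gibbs u₀ ha hθ hσ N Φ
  unfold Bound
  simp only [badCount_eq_zero_of_T_neg hT, Nat.cast_zero, mul_zero, Real.exp_zero,
    ENNReal.ofReal_one, lintegral_const, measure_univ, mul_one]
  exact ENNReal.one_le_ofReal.2 (Real.one_le_exp (by positivity))

/-! ## (B) The kill criterion (Chebyshev form of the bound) -/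

/-- CHEBYSHEV: the bound at `(lam, δ)` forces every measurable event on which at least `m`
particles are bad to have `G_N`-probability `≤ exp(δ(N+1) − lam·m)`. -/
theorem measure_le_of_bound {σ a θ T lam δ R : ℝ} {u₀ : V3} {N : ℕ} {Φ : Flow σ N}
    {Ψ : ClusterFlows σ N} (hB : Bound a θ u₀ σ T lam δ R N Φ Ψ) (hlam : 0 ≤ lam)
    {A : Set (Config (N + 1) (Fin 3) T3)} (hA : MeasurableSet A) {m : ℕ}
    (hm : ∀ z ∈ A, m ≤ badCount σ T R N Φ Ψ z) :
    gibbs σ a θ u₀ N Φ A ≤ ENNReal.ofReal (Real.exp (δ * (N + 1) - lam * m)) := by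
  have key : ENNReal.ofReal (Real.exp (lam * m)) * gibbs σ a θ u₀ N Φ A ≤
      ENNReal.ofReal (Real.exp (δ * (N + 1))) := by
    calc ENNReal.ofReal (Real.exp (lam * m)) * gibbs σ a θ u₀ N Φ A
        = ∫⁻ z, A.indicator (fun _ => ENNReal.ofReal (Real.exp (lam * m))) z
            ∂(gibbs σ a θ u₀ N Φ) := (lintegral_indicator_const hA _).symm
      _ ≤ ∫⁻ z, ENNReal.ofReal (Real.exp (lam * (badCount σ T R N Φ Ψ z : ℝ)))
            ∂(gibbs σ a θ u₀ N Φ) := by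
          refine lintegral_mono fun z => ?_
          by_cases hz : z ∈ A
          · simp only [Set.indicator_of_mem hz]
            refine ENNReal.ofReal_le_ofReal (Real.exp_le_exp.2 ?_)
            exact mul_le_mul_of_nonneg_left (by exact_mod_cast hm z hz) hlam
          · simp only [Set.indicator_of_notMem hz, zero_le]
      _ ≤ _ := hB
  rw [Real.exp_sub, ENNReal.ofReal_div_of_pos (Real.exp_pos _),
    ENNReal.le_div_iff_mul_le (Or.inl (ENNReal.ofReal_pos.2 (Real.exp_pos _)).ne')
      (Or.inl ENNReal.ofReal_ne_top), mul_comm]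
  exact key

/-- THE KILL CRITERION (contrapositive of `measure_le_of_bound` through the quantifier shell):
to refute the crux it suffices to exhibit, for some admissible `(a, θ, u₀)`, arbitrarily small
`σ`, one `(T, lam, δ)`, and for EVERY range `R` and threshold `N₀`, a particle number `N ≥ N₀`,
flows, and a measurable event `A` with `#bad ≥ m` on `A` and `G_N(A) > exp(δ(N+1) − lam·m)` —
i.e. bad fractions `m/(N+1) = ε` at LD cost per bad particle `< lam − δ/ε`, UNIFORMLY IN `R`. -/
theorem not_influenceLocality_of_witness
    (h : ∃ (a θ : ℝ) (u₀ : V3), 0 < a ∧ 0 < θ ∧ ∀ σ₀ : ℝ, 0 < σ₀ → ∃ σ : ℝ, 0 < σ ∧ σ < σ₀ ∧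
      ∃ (T lam δ : ℝ), 0 < T ∧ 0 < lam ∧ 0 < δ ∧ ∀ R : ℝ, 0 < R → ∀ N₀ : ℕ, ∃ N : ℕ, N₀ ≤ N ∧
      ∃ (Φ : Flow σ N) (Ψ : ClusterFlows σ N) (A : Set (Config (N + 1) (Fin 3) T3)) (m : ℕ),
        MeasurableSet A ∧ (∀ z ∈ A, m ≤ badCount σ T R N Φ Ψ z) ∧
        ENNReal.ofReal (Real.exp (δ * (N + 1) - lam * m)) < gibbs σ a θ u₀ N Φ A) :
    ¬ InfluenceLocality := by
  rw [influenceLocality_iff]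
  rintro hIL
  obtain ⟨a, θ, u₀, ha, hθ, h⟩ := h
  obtain ⟨σ₀, hσ₀, hσ⟩ := hIL a θ u₀ ha hθ
  obtain ⟨σ, hσpos, hσlt, T, lam, δ, hT, hlam, hδ, hR⟩ := h σ₀ hσ₀
  obtain ⟨R, hRpos, N₀, hN⟩ := hσ σ hσpos hσlt T lam δ hT hlam hδ
  obtain ⟨N, hN₀, Φ, Ψ, A, m, hA, hm, hlt⟩ := hR R hRpos N₀
  exact (not_le.2 hlt) (measure_le_of_bound (hN N hN₀ Φ Ψ) hlam.le hA hm)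


/-- LOWER SPLIT: on a probability space, an event `A` carrying at least `m` bad particles pushes
the exponential moment up to `G(Aᶜ) + e^{lam m}·G(A) = 1 + (e^{lam m} − 1)·G(A)`. -/
theorem lintegral_ge_split {σ a θ T lam R : ℝ} {u₀ : V3} {N : ℕ} {Φ : Flow σ N}
    {Ψ : ClusterFlows σ N} (hlam : 0 ≤ lam) {A : Set (Config (N + 1) (Fin 3) T3)}
    (hA : MeasurableSet A) {m : ℕ} (hm : ∀ z ∈ A, m ≤ badCount σ T R N Φ Ψ z) :
    gibbs σ a θ u₀ N Φ Aᶜ + ENNReal.ofReal (Real.exp (lam * m)) * gibbs σ a θ u₀ N Φ A ≤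
      ∫⁻ z, ENNReal.ofReal (Real.exp (lam * (badCount σ T R N Φ Ψ z : ℝ))) ∂(gibbs σ a θ u₀ N Φ) := by
  have h1 : gibbs σ a θ u₀ N Φ Aᶜ = ∫⁻ z, Aᶜ.indicator (fun _ => (1 : ℝ≥0∞)) z ∂(gibbs σ a θ u₀ N Φ) := by
    rw [lintegral_indicator_const hA.compl, one_mul]
  have h2 : ENNReal.ofReal (Real.exp (lam * m)) * gibbs σ a θ u₀ N Φ A =
      ∫⁻ z, A.indicator (fun _ => ENNReal.ofReal (Real.exp (lam * m))) z ∂(gibbs σ a θ u₀ N Φ) :=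
    (lintegral_indicator_const hA _).symm
  rw [h1, h2, ← lintegral_add_left (measurable_const.indicator hA.compl)]
  refine lintegral_mono fun z => ?_
  by_cases hz : z ∈ A
  · simp only [Set.indicator_of_notMem (Set.notMem_compl_iff.2 hz), Set.indicator_of_mem hz,
      zero_add]
    refine ENNReal.ofReal_le_ofReal (Real.exp_le_exp.2 ?_)
    exact mul_le_mul_of_nonneg_left (by exact_mod_cast hm z hz) hlam
  · simp only [Set.indicator_of_mem (Set.mem_compl hz), Set.indicator_of_notMem hz, add_zero]
    exact ENNReal.one_le_ofReal.2 (Real.one_le_exp (mul_nonneg hlam (Nat.cast_nonneg _)))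

/-! ## (C) Natural strengthenings and the dynamical input their refutation needs

Every refutation of a variant of the crux needs ONE dynamical fact about the actual hard-sphere
flow (the tree HAS the flow: `HardSphereFlow.nonempty_torus_holds`, Alexander's theorem, proved):
a `G_N`-non-negligible event on which forecasts are provably corrupted. We isolate the two
weakest such facts as hypotheses and prove the refutations MODULO them; the facts themselves are
the near-misses of §(E). -/

/-- DYNAMICAL INPUT 1 (positive-probability corruption at fixed range): at reduced density `σ`,
horizon `T` and range `R` there are `p > 0` and `N₀` such that for every `N ≥ N₀` some flows and
some measurable event of `G_N`-mass `≥ p` carry at least one bad particle. Physically obvious (an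
intruder from outside `B(x₀, Rℓ)` with speed `≈ 2R√θ/T` hits particle `0` while everything else
stays away; Maxwellian tails give `p ≈ c(σT)·(R/T)·e^{-2R²/T²} > 0` independent of `N`); see §(E)
for the formalisation plan and its cost. -/
def CorruptionEvent (a θ : ℝ) (u₀ : V3) (σ T R : ℝ) : Prop :=
  ∃ p : ℝ≥0∞, 0 < p ∧ ∃ N₀ : ℕ, ∀ N : ℕ, N₀ ≤ N → ∃ (Φ : Flow σ N) (Ψ : ClusterFlows σ N)
    (A : Set (Config (N + 1) (Fin 3) T3)), MeasurableSet A ∧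
    (∀ z ∈ A, 1 ≤ badCount σ T R N Φ Ψ z) ∧ p ≤ gibbs σ a θ u₀ N Φ A

/-- DYNAMICAL INPUT 2 (a bad FRACTION is typical at fixed range): at `(σ, T, R)` there are a
fraction `ε > 0` and `N₀` such that for `N ≥ N₀` some flows make `#bad ≥ ε(N+1)` with
`G_N`-probability `≥ 1/2`. Physically: `#bad/(N+1) → p_bad(σ,T,R) > 0` in probability (law of
large numbers for a local observable of a Gibbs state with good mixing at small `σ`). -/
def TypicalBadFraction (a θ : ℝ) (u₀ : V3) (σ T R : ℝ) : Prop :=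
  ∃ ε : ℝ, 0 < ε ∧ ∃ N₀ : ℕ, ∀ N : ℕ, N₀ ≤ N → ∃ (Φ : Flow σ N) (Ψ : ClusterFlows σ N)
    (A : Set (Config (N + 1) (Fin 3) T3)) (m : ℕ), MeasurableSet A ∧ ε * (N + 1) ≤ m ∧
    (∀ z ∈ A, m ≤ badCount σ T R N Φ Ψ z) ∧ 2⁻¹ ≤ gibbs σ a θ u₀ N Φ A

/-- STRENGTHENING 1 — NO SLACK (`δ = 0`): `∫ exp(lam·#bad) dG_N ≤ 1`. -/
def WithoutDelta : Prop :=
  ∀ (a θ : ℝ) (u₀ : V3), 0 < a → 0 < θ → ∃ σ₀ : ℝ, 0 < σ₀ ∧ ∀ σ : ℝ, 0 < σ → σ < σ₀ →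
    ∀ (T lam : ℝ), 0 < T → 0 < lam → ∃ R : ℝ, 0 < R ∧ ∃ N₀ : ℕ, ∀ N : ℕ, N₀ ≤ N →
    ∀ (Φ : Flow σ N) (Ψ : ClusterFlows σ N), Bound a θ u₀ σ T lam 0 R N Φ Ψ

/-- `WithoutDelta` is a strengthening of the crux (the bound is monotone in `δ`). -/
theorem influenceLocality_of_withoutDelta (h : WithoutDelta) : InfluenceLocality := by
  rw [influenceLocality_iff]
  intro a θ u₀ ha hθ
  obtain ⟨σ₀, hσ₀, hσ⟩ := h a θ u₀ ha hθ
  refine ⟨σ₀, hσ₀, fun σ hs hs' T lam δ hT hlam hδ => ?_⟩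
  obtain ⟨R, hR, N₀, hN⟩ := hσ σ hs hs' T lam hT hlam
  refine ⟨R, hR, N₀, fun N hN₀ Φ Ψ => (hN N hN₀ Φ Ψ).trans ?_⟩
  exact ENNReal.ofReal_le_ofReal (Real.exp_le_exp.2 (by nlinarith [hδ.le]))

/-- `δ > 0` IS LOAD-BEARING (modulo dynamical input 1): if corruption events of `N`-independent
positive probability exist at every small `σ` for `T = 1` and every range `R`, the no-slack
version is false — `∫ exp(lam·#bad) ≥ 1 + (e^{lam} − 1)·p > 1`. -/
theorem withoutDelta_false_of_corruption
    (h : ∀ σ₀ : ℝ, 0 < σ₀ → ∃ σ : ℝ, 0 < σ ∧ σ < σ₀ ∧ σ ≤ 1 / 2 ∧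
      ∀ R : ℝ, 0 < R → CorruptionEvent 1 1 0 σ 1 R) :
    ¬ WithoutDelta := by
  intro hW
  obtain ⟨σ₀, hσ₀, hσ⟩ := hW 1 1 0 one_pos one_pos
  obtain ⟨σ, hs, hs', hs2, hR⟩ := h σ₀ hσ₀
  obtain ⟨R, hRpos, N₀, hN⟩ := hσ σ hs hs' 1 1 one_pos one_pos
  obtain ⟨p, hp, N₁, hN₁⟩ := hR R hRpos
  obtain ⟨Φ, Ψ, A, hA, hbad, hpA⟩ := hN₁ (max N₀ N₁) (le_max_right _ _)
  have hB := hN (max N₀ N₁) (le_max_left _ _) Φ Ψ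
  haveI := isProbabilityMeasure_gibbs (σ := σ) (a := 1) (θ := 1) (0 : V3) one_pos one_pos hs2
    (max N₀ N₁) Φ
  have hsplit := lintegral_ge_split (σ := σ) (a := 1) (θ := 1) (u₀ := (0 : V3)) (T := 1)
    (lam := 1) (R := R) (Φ := Φ) (Ψ := Ψ) zero_le_one hA (m := 1) hbad
  unfold Bound at hB
  have hle := hsplit.trans hB
  simp only [zero_mul, Real.exp_zero, ENNReal.ofReal_one, Nat.cast_one, mul_one] at hle
  -- hle : G Aᶜ + ofReal (exp 1) * G A ≤ 1
  have hcompl : gibbs σ 1 1 0 (max N₀ N₁) Φ Aᶜ = 1 - gibbs σ 1 1 0 (max N₀ N₁) Φ A :=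
    prob_compl_eq_one_sub hA
  have hA1 : gibbs σ 1 1 0 (max N₀ N₁) Φ A ≤ 1 := prob_le_one
  have hAtop : gibbs σ 1 1 0 (max N₀ N₁) Φ A ≠ ∞ := ne_top_of_le_ne_top ENNReal.one_ne_top hA1
  rw [hcompl] at hle
  -- 1 - G A + e * G A ≤ 1  ⇒ (e - 1) * G A ≤ 0 ⇒ G A = 0, contradicting p ≤ G A, 0 < p
  have hGA0 : gibbs σ 1 1 0 (max N₀ N₁) Φ A = 0 := by
    by_contra hne
    have hpos : 0 < gibbs σ 1 1 0 (max N₀ N₁) Φ A := pos_iff_ne_zero.2 hne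
    have hgt : (1 : ℝ≥0∞) < 1 - gibbs σ 1 1 0 (max N₀ N₁) Φ A +
        ENNReal.ofReal (Real.exp 1) * gibbs σ 1 1 0 (max N₀ N₁) Φ A := by
      have he : (1 : ℝ≥0∞) < ENNReal.ofReal (Real.exp 1) := by
        rw [← ENNReal.ofReal_one]
        exact (ENNReal.ofReal_lt_ofReal_iff (Real.exp_pos 1)).2 (by
          have := Real.add_one_lt_exp (x := (1 : ℝ)) one_ne_zero; linarith)
      calc (1 : ℝ≥0∞) = 1 - gibbs σ 1 1 0 (max N₀ N₁) Φ A + 1 * gibbs σ 1 1 0 (max N₀ N₁) Φ A := by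
            rw [one_mul, tsub_add_cancel_of_le hA1]
        _ < 1 - gibbs σ 1 1 0 (max N₀ N₁) Φ A +
            ENNReal.ofReal (Real.exp 1) * gibbs σ 1 1 0 (max N₀ N₁) Φ A := by
            refine ENNReal.add_lt_add_left ?_ ?_
            · exact ne_top_of_le_ne_top ENNReal.one_ne_top tsub_le_self
            · have hmul := ENNReal.mul_lt_mul_right hne hAtop he
              simpa only [mul_comm] using hmul
    exact (not_lt.2 hle) hgt
  exact (lt_irrefl 0) (hp.trans_le (hpA.trans_eq hGA0))

/-- STRENGTHENING 2 — RANGE BEFORE RATE (`∃ R ∀ lam`). -/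
def UniformInLam : Prop :=
  ∀ (a θ : ℝ) (u₀ : V3), 0 < a → 0 < θ → ∃ σ₀ : ℝ, 0 < σ₀ ∧ ∀ σ : ℝ, 0 < σ → σ < σ₀ →
    ∀ (T δ : ℝ), 0 < T → 0 < δ → ∃ R : ℝ, 0 < R ∧ ∀ lam : ℝ, 0 < lam → ∃ N₀ : ℕ, ∀ N : ℕ,
    N₀ ≤ N → ∀ (Φ : Flow σ N) (Ψ : ClusterFlows σ N), Bound a θ u₀ σ T lam δ R N Φ Ψ

/-- `UniformInLam` is a strengthening of the crux (pure quantifier exchange). -/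
theorem influenceLocality_of_uniformInLam (h : UniformInLam) : InfluenceLocality := by
  rw [influenceLocality_iff]
  intro a θ u₀ ha hθ
  obtain ⟨σ₀, hσ₀, hσ⟩ := h a θ u₀ ha hθ
  refine ⟨σ₀, hσ₀, fun σ hs hs' T lam δ hT hlam hδ => ?_⟩
  obtain ⟨R, hR, hl⟩ := hσ σ hs hs' T δ hT hδ
  obtain ⟨N₀, hN⟩ := hl lam hlam
  exact ⟨R, hR, N₀, hN⟩

/-- THE ORDER `lam` BEFORE `R` IS LOAD-BEARING (modulo dynamical input 2): if at every small `σ`,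
for `T = 1` and every range `R`, a positive bad fraction `ε(R)` is typical, then `UniformInLam`
is false — Chebyshev at `lam = 4δ/ε` gives `G_N(#bad ≥ ε(N+1)) ≤ e^{-3δ(N+1)} < 1/2`. -/
theorem uniformInLam_false_of_typicalBadFraction
    (h : ∀ σ₀ : ℝ, 0 < σ₀ → ∃ σ : ℝ, 0 < σ ∧ σ < σ₀ ∧
      ∀ R : ℝ, 0 < R → TypicalBadFraction 1 1 0 σ 1 R) :
    ¬ UniformInLam := by
  intro hU
  obtain ⟨σ₀, hσ₀, hσ⟩ := hU 1 1 0 one_pos one_pos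
  obtain ⟨σ, hs, hs', hR⟩ := h σ₀ hσ₀
  obtain ⟨R, hRpos, hl⟩ := hσ σ hs hs' 1 1 one_pos one_pos
  obtain ⟨ε, hε, N₁, hN₁⟩ := hR R hRpos
  obtain ⟨N₀, hN⟩ := hl (4 / ε) (by positivity)
  obtain ⟨Φ, Ψ, A, m, hA, hεm, hbad, hhalf⟩ := hN₁ (max N₀ N₁) (le_max_right _ _)
  have hB := hN (max N₀ N₁) (le_max_left _ _) Φ Ψ
  have hcheb := measure_le_of_bound hB (by positivity) hA hbad
  -- exponent: 1 * (N+1) - (4/ε) * m ≤ (N+1) - 4 (N+1) = -3 (N+1) ≤ -3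
  have hexp : (1 : ℝ) * ((max N₀ N₁ : ℕ) + 1) - 4 / ε * m ≤ -3 := by
    have h4 : 4 / ε * (ε * ((max N₀ N₁ : ℕ) + 1)) ≤ 4 / ε * m :=
      mul_le_mul_of_nonneg_left hεm (by positivity)
    have h4' : 4 / ε * (ε * ((max N₀ N₁ : ℕ) + 1)) = 4 * ((max N₀ N₁ : ℕ) + 1) := by
      field_simp
    have hN0 : (0 : ℝ) ≤ (max N₀ N₁ : ℕ) := Nat.cast_nonneg _
    nlinarith
  have hlt : ENNReal.ofReal (Real.exp ((1 : ℝ) * ((max N₀ N₁ : ℕ) + 1) - 4 / ε * m)) < 2⁻¹ := by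
    have h3 : Real.exp (-3 : ℝ) < 2⁻¹ := by
      have h := Real.exp_one_gt_d9
      have hpos := Real.exp_pos (1 : ℝ)
      rw [show (-3 : ℝ) = -(3 : ℝ) by ring, Real.exp_neg]
      rw [show (3 : ℝ) = 1 + 1 + 1 by norm_num, Real.exp_add, Real.exp_add]
      rw [inv_lt_comm₀ (by positivity) (by norm_num)]
      nlinarith
    calc ENNReal.ofReal (Real.exp ((1 : ℝ) * ((max N₀ N₁ : ℕ) + 1) - 4 / ε * m))
        ≤ ENNReal.ofReal (Real.exp (-3)) := ENNReal.ofReal_le_ofReal (Real.exp_le_exp.2 hexp)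
      _ < ENNReal.ofReal (2⁻¹ : ℝ) := (ENNReal.ofReal_lt_ofReal_iff (by norm_num)).2 h3
      _ = 2⁻¹ := by rw [ENNReal.ofReal_inv_of_pos two_pos, ENNReal.ofReal_ofNat]
  have hm1 : ((max N₀ N₁ : ℕ) : ℝ) + 1 = ((max N₀ N₁ : ℕ) + 1 : ℕ) := by push_cast; ring
  exact (not_lt.2 (hhalf.trans hcheb)) (by simpa using hlt)

/-! ## (D) The recommended shape for the consumer: eventual-in-`R`

POINTWISE NON-MONOTONICITY IN `R` (paper, three spheres): badness at range `R₂` does not imply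
badness at a smaller range `R₁ < R₂`, nor conversely. Witness: particle `i` at rest-ish; `j` at
distance `r ∈ (R₁ℓ, R₂ℓ)` heading for `i` (would hit at `t₁ < Tℓ`); an intruder `k` from
distance `> R₂ℓ` knocks `j` off course at `t₀ < t₁`. Truth: `i` flies freely. Forecast at
`R₁`: cluster `{i}`, free flight = truth, GOOD. Forecast at `R₂`: cluster `{i, j}` without `k`,
`j` hits `i`, BAD. (Open conditions: a `G_N`-positive event.) CONSEQUENCE FOR stmt-13917
(LocalCertificateTransfer): its proof plan picks `R ≥ max(R₀(T), R_loc(T+λ, lam, δ))`, i.e. it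
consumes the bound at a range possibly LARGER than the `R` this crux provides (`∃ R`), and the
bound at `R` does not imply the bound at `R' ≥ R`. The shape the transfer actually consumes is
the eventual one below; it implies the crux and is (heuristically) equally true. Planner: either
re-type 13916 as `InfluenceLocalityEventually` or make 13917's proof choose `R₀(T) ≤ R_loc`. -/

/-- EVENTUAL-IN-`R` form of the crux (`∃ R₀ ∀ R ≥ R₀` instead of `∃ R`). -/
def InfluenceLocalityEventually : Prop :=
  ∀ (a θ : ℝ) (u₀ : V3), 0 < a → 0 < θ → ∃ σ₀ : ℝ, 0 < σ₀ ∧ ∀ σ : ℝ, 0 < σ → σ < σ₀ →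
    ∀ (T lam δ : ℝ), 0 < T → 0 < lam → 0 < δ → ∃ R₀ : ℝ, 0 < R₀ ∧ ∀ R : ℝ, R₀ ≤ R →
    ∃ N₀ : ℕ, ∀ N : ℕ, N₀ ≤ N → ∀ (Φ : Flow σ N) (Ψ : ClusterFlows σ N),
    Bound a θ u₀ σ T lam δ R N Φ Ψ

/-- The eventual form implies the crux (take `R = R₀`). The converse is NOT formal (no
monotonicity in `R`). -/
theorem influenceLocality_of_eventually (h : InfluenceLocalityEventually) : InfluenceLocality := by
  rw [influenceLocality_iff]
  intro a θ u₀ ha hθ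
  obtain ⟨σ₀, hσ₀, hσ⟩ := h a θ u₀ ha hθ
  refine ⟨σ₀, hσ₀, fun σ hs hs' T lam δ hT hlam hδ => ?_⟩
  obtain ⟨R₀, hR₀, hR⟩ := hσ σ hs hs' T lam δ hT hlam hδ
  obtain ⟨N₀, hN⟩ := hR R₀ le_rfl
  exact ⟨R₀, hR₀, N₀, hN⟩


/-! ## (F) Certifying corruption WITHOUT computing the dynamics

Two spheres `i ≠ j`, each ISOLATED at time `0` (nobody within the forecast range `Rℓ`), whose
FREE flights overlap (`< ε` apart in the torus chart) at some time `t ∈ [0, Tℓ]`: then at least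
one of them is bad, for EVERY flow `Φ` (good orbits stay in the hard-sphere domain) and every
cluster family `Ψ` whose one-particle flow is free flight on an everywhere-good set (e.g. the
tree's Alexander flow, `alexanderFlow` below). This is the deterministic half of near-miss 1. -/

section Certification

/-- The tree's collision-by-collision (Alexander) flow on `𝕋³`, as a `HardSphereFlow` structure
with EXPLICIT fields (`HardSphereFlow.nonempty_torus_of_construction` only gives `Nonempty`). -/
def alexanderFlow {ε : ℝ} (hε : 0 < ε) (hε' : ε < 2⁻¹) (k : ℕ) :
    HardSphereFlow (Torus.geometry (Fin 3)) ε k where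
  flow := Alexander.flow (Torus.geometry (Fin 3)) ε
  good := Alexander.good (Torus.geometry (Fin 3)) ε
  measurableSet_good := (Alexander.torusFlow_measurable_holds hε hε' k).1
  good_subset := Alexander.good_subset_hardSphereDomain
  measure_compl_good := Alexander.torusFlow_ae_good_holds hε hε' k
  mapsTo_good := (Alexander.torusFlow_group_holds hε hε' k).1
  flow_zero := (Alexander.torusFlow_group_holds hε hε' k).2.1
  flow_add := (Alexander.torusFlow_group_holds hε hε' k).2.2
  measurable_flow := (Alexander.torusFlow_measurable_holds hε hε' k).2
  isTrajectory := Alexander.torusFlow_isTrajectory_holds hε hε' k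
  measurePreserving := Alexander.torusFlow_measurePreserving_holds hε hε' k

/-- One sphere alone: the hard-sphere domain is everything. -/
theorem hardSphereDomain_one (ε : ℝ) :
    hardSphereDomain (Torus.geometry (Fin 3)) 1 ε = (Set.univ : Set (Config 1 (Fin 3) T3)) := by
  ext z
  simp only [mem_hardSphereDomain, Set.mem_univ, iff_true]
  intro i j hij
  exact absurd (Subsingleton.elim i j) hij

/-- One sphere alone never collides. -/
theorem freeExitTime_one (ε : ℝ) (w : Config 1 (Fin 3) T3) :
    Alexander.freeExitTime (Torus.geometry (Fin 3)) ε w = ∞ :=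
  Alexander.freeExitTime_eq_top_iff.2 fun t _ => by rw [hardSphereDomain_one]; exact Set.mem_univ _

/-- One sphere alone is forward-good. -/
theorem fwdGood_one (ε : ℝ) (w : Config 1 (Fin 3) T3) :
    Alexander.FwdGood (Torus.geometry (Fin 3)) ε w :=
  ⟨fun _ hk => absurd (freeExitTime_one ε _) hk,
    fun _ _ _ _ i j hij => absurd (Subsingleton.elim i j) hij,
    ENNReal.tsum_eq_top_of_eq_top ⟨0, freeExitTime_one ε _⟩⟩

/-- One sphere alone: every datum is good for the Alexander flow. -/
theorem alexander_good_one (ε : ℝ) :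
    Alexander.good (Torus.geometry (Fin 3)) ε = (Set.univ : Set (Config 1 (Fin 3) T3)) := by
  ext w
  simp only [Set.mem_univ, iff_true]
  refine ⟨by rw [hardSphereDomain_one]; exact Set.mem_univ _, fun i j hij => absurd (Subsingleton.elim i j) hij,
    fwdGood_one ε w, fwdGood_one ε (flipVel w)⟩

/-- One sphere alone: the Alexander flow is free flight (forward times). -/
theorem alexander_flow_one (ε : ℝ) {t : ℝ} (ht : 0 ≤ t) (w : Config 1 (Fin 3) T3) :
    Alexander.flow (Torus.geometry (Fin 3)) ε t w = freeFlight (Torus.geometry (Fin 3)) t w :=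
  Alexander.flow_eq_freeFlight_of_lt ht (by rw [freeExitTime_one]; exact ENNReal.ofReal_lt_top)

/-- The property of a cluster family actually used: its ONE-particle flow is free flight on an
everywhere-good set. -/
def SingletonFree {σ : ℝ} {N : ℕ} (Ψ : ClusterFlows σ N) : Prop :=
  ∀ n, n = 1 → (Ψ n).good = Set.univ ∧
    ∀ (t : ℝ) (w : Config n (Fin 3) T3), 0 ≤ t → (Ψ n).flow t w = freeFlight (Torus.geometry (Fin 3)) t w

/-- The Alexander cluster family has the property. -/
theorem singletonFree_alexander {σ : ℝ} {N : ℕ} (hε : 0 < hsDiameter σ N)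
    (hε' : hsDiameter σ N < 2⁻¹) :
    SingletonFree (σ := σ) (N := N) (fun k => alexanderFlow hε hε' k) := by
  rintro n rfl
  exact ⟨alexander_good_one _, fun t w ht => alexander_flow_one _ ht w⟩

/-- For a cluster of ONE sphere and a `SingletonFree` family, the isolated evolution is free
flight. -/
theorem clusterStateIn_card_one {σ : ℝ} {N : ℕ} {Ψ : ClusterFlows σ N} (hΨ : SingletonFree Ψ)
    (S : Finset (Fin (N + 1))) (hS : S.card = 1) (m : Fin S.card) {t : ℝ} (ht : 0 ≤ t)
    (z : Config (N + 1) (Fin 3) T3) :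
    clusterStateIn Ψ S m t z = freeFlight (Torus.geometry (Fin 3)) t (Config.restrictTo S z) m := by
  obtain ⟨hg, hf⟩ := hΨ S.card hS
  unfold clusterStateIn
  rw [Set.piecewise_eq_of_mem _ _ _ (by rw [hg]; exact Set.mem_univ _), hf t _ ht]

/-- ISOLATION ⇒ the range cluster is the singleton. -/
theorem rangeCluster_eq_singleton {N : ℕ} {r : ℝ} {z : Config (N + 1) (Fin 3) T3} {i : Fin (N + 1)}
    (hi : ∀ k, k ≠ i → r < ‖(Torus.geometry (Fin 3)).sepVec (z i).1 (z k).1‖) :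
    rangeCluster (Torus.geometry (Fin 3)) r z i = {i} := by
  ext k
  rw [mem_rangeCluster, Finset.mem_singleton]
  constructor
  · rintro (rfl | hk)
    · rfl
    · by_contra hki
      exact (not_le.2 (hi k hki)) hk
  · rintro rfl
    exact Or.inl rfl

/-- ISOLATION ⇒ the local forecast of `i` is its free flight (position translated, velocity
kept), for a `SingletonFree` family. -/
theorem localClusterState_of_isolated {σ : ℝ} {N : ℕ} {Ψ : ClusterFlows σ N} (hΨ : SingletonFree Ψ)
    {r : ℝ} {z : Config (N + 1) (Fin 3) T3} {i : Fin (N + 1)}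
    (hi : ∀ k, k ≠ i → r < ‖(Torus.geometry (Fin 3)).sepVec (z i).1 (z k).1‖) {t : ℝ} (ht : 0 ≤ t) :
    localClusterState Ψ r t z i =
      ((Torus.geometry (Fin 3)).translate (z i).1 (t • (z i).2), (z i).2) := by
  have hcard : (rangeCluster (Torus.geometry (Fin 3)) r z i).card = 1 := by
    rw [rangeCluster_eq_singleton hi, Finset.card_singleton]
  unfold localClusterState
  rw [clusterStateIn_card_one hΨ _ hcard _ ht, freeFlight_apply, Config.restrictTo_clusterIndex]

/-- **CERTIFICATION LEMMA.** Two isolated spheres whose free flights overlap inside the window: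
at least one of them is bad. No property of `Φ` beyond the structure axioms is used. -/
theorem one_le_badCount_of_isolated_overlap {σ T R : ℝ} {N : ℕ} (Φ : Flow σ N)
    {Ψ : ClusterFlows σ N} (hΨ : SingletonFree Ψ) {z : Config (N + 1) (Fin 3) T3}
    (hz : z ∈ Φ.good) {i j : Fin (N + 1)} (hij : i ≠ j)
    (hi : ∀ k, k ≠ i → R * ell N < ‖(Torus.geometry (Fin 3)).sepVec (z i).1 (z k).1‖)
    (hj : ∀ k, k ≠ j → R * ell N < ‖(Torus.geometry (Fin 3)).sepVec (z j).1 (z k).1‖)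
    {t : ℝ} (ht0 : 0 ≤ t) (htT : t ≤ T * ell N)
    (hchart : ‖(Torus.geometry (Fin 3)).sepVec (z i).1 (z j).1‖ + ‖t • (z i).2 - t • (z j).2‖ < 1 / 2)
    (hoverlap : ‖(Torus.geometry (Fin 3)).sepVec (z i).1 (z j).1 + (t • (z i).2 - t • (z j).2)‖ <
      hsDiameter σ N) :
    1 ≤ badCount σ T R N Φ Ψ z := by
  unfold badCount
  by_contra hlt
  have hempty : (Finset.univ.filter fun i : Fin (N + 1) => ∃ s ∈ Set.Icc (0 : ℝ) (T * ell N),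
      Φ.flow s z i ≠ localClusterState Ψ (R * ell N) s z i) = ∅ :=
    Finset.card_eq_zero.1 (by omega)
  have hgood : ∀ k, Φ.flow t z k = localClusterState Ψ (R * ell N) t z k := by
    intro k
    by_contra hne
    have hk : k ∈ (Finset.univ.filter fun i : Fin (N + 1) => ∃ s ∈ Set.Icc (0 : ℝ) (T * ell N),
        Φ.flow s z i ≠ localClusterState Ψ (R * ell N) s z i) :=
      Finset.mem_filter.2 ⟨Finset.mem_univ _, t, ⟨ht0, htT⟩, hne⟩
    rw [hempty] at hk
    exact Finset.notMem_empty _ hk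
  have hti := hgood i
  have htj := hgood j
  rw [localClusterState_of_isolated hΨ hi ht0] at hti
  rw [localClusterState_of_isolated hΨ hj ht0] at htj
  have hdom : Φ.flow t z ∈ hardSphereDomain (Torus.geometry (Fin 3)) (N + 1) (hsDiameter σ N) :=
    Φ.good_subset (Φ.mapsTo_good t hz)
  have hsep := hdom i j hij
  rw [hti, htj] at hsep
  dsimp only at hsep
  rw [Torus.sepVec_translate_of_norm_lt hchart] at hsep
  exact (not_lt.2 hsep) hoverlap

/-- `G_N ≪ Liouville` (it is `liouville.withDensity` of the canonical density). -/
theorem gibbs_absolutelyContinuous (σ a θ : ℝ) (u₀ : V3) (N : ℕ) (Φ : Flow σ N) :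
    gibbs σ a θ u₀ N Φ ≪ liouville (Torus.geometry (Fin 3)) (N + 1) (hsDiameter σ N) := by
  unfold gibbs Literature.MathematicalPhysics.KineticTheory.localGibbsLaw
  rw [particleLaw_eq]
  exact withDensity_absolutelyContinuous _ _

/-- The junk of `Φ` off its good set is `G_N`-null. -/
theorem gibbs_compl_good (σ a θ : ℝ) (u₀ : V3) (N : ℕ) (Φ : Flow σ N) :
    gibbs σ a θ u₀ N Φ Φ.goodᶜ = 0 :=
  gibbs_absolutelyContinuous σ a θ u₀ N Φ Φ.measure_compl_good

/-- THE WITNESS EVENT of near-miss 1 for the pair `(i, j)`: both isolated at range `Rℓ`, and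
their free flights `< ε` apart (in the chart) at the half-window time `Tℓ/2`. Open conditions on
the positions of all spheres and on the velocities of `i, j` only. -/
def AimedPair (σ T R : ℝ) (N : ℕ) (i j : Fin (N + 1)) : Set (Config (N + 1) (Fin 3) T3) :=
  {z | (∀ k, k ≠ i → R * ell N < ‖(Torus.geometry (Fin 3)).sepVec (z i).1 (z k).1‖) ∧
    (∀ k, k ≠ j → R * ell N < ‖(Torus.geometry (Fin 3)).sepVec (z j).1 (z k).1‖) ∧
    ‖(Torus.geometry (Fin 3)).sepVec (z i).1 (z j).1‖ +
        ‖(T * ell N / 2) • (z i).2 - (T * ell N / 2) • (z j).2‖ < 1 / 2 ∧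
    ‖(Torus.geometry (Fin 3)).sepVec (z i).1 (z j).1 +
        ((T * ell N / 2) • (z i).2 - (T * ell N / 2) • (z j).2)‖ < hsDiameter σ N}

/-- The union over partners `j ≠ 0` of the witness events of the pair `(0, j)` (a disjoint
union as soon as `R ≥ 0`, by the isolation clauses). -/
def AimedPairs (σ T R : ℝ) (N : ℕ) : Set (Config (N + 1) (Fin 3) T3) :=
  ⋃ j ∈ {j : Fin (N + 1) | j ≠ 0}, AimedPair σ T R N 0 j

/-- Measurability of the separation of two labelled spheres. -/
theorem measurable_sepVec_coord {N : ℕ} (i k : Fin (N + 1)) :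
    Measurable fun z : Config (N + 1) (Fin 3) T3 => (Torus.geometry (Fin 3)).sepVec (z i).1 (z k).1 :=
  Torus.measurable_geometry_sepVec.comp ((measurable_pi_apply i).fst.prodMk (measurable_pi_apply k).fst)

/-- Measurability of the scaled relative velocity of two labelled spheres. -/
theorem measurable_relVel_coord {N : ℕ} (c : ℝ) (i j : Fin (N + 1)) :
    Measurable fun z : Config (N + 1) (Fin 3) T3 => c • (z i).2 - c • (z j).2 :=
  ((measurable_pi_apply i).snd.const_smul c).sub ((measurable_pi_apply j).snd.const_smul c)

/-- The witness event is measurable. -/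
theorem measurableSet_aimedPair (σ T R : ℝ) (N : ℕ) (i j : Fin (N + 1)) :
    MeasurableSet (AimedPair σ T R N i j) := by
  have hiso : ∀ i : Fin (N + 1), MeasurableSet {z : Config (N + 1) (Fin 3) T3 |
      ∀ k, k ≠ i → R * ell N < ‖(Torus.geometry (Fin 3)).sepVec (z i).1 (z k).1‖} := by
    intro i
    have hset : {z : Config (N + 1) (Fin 3) T3 |
        ∀ k, k ≠ i → R * ell N < ‖(Torus.geometry (Fin 3)).sepVec (z i).1 (z k).1‖} =
        ⋂ (k : Fin (N + 1)) (_ : k ≠ i),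
          {z | R * ell N < ‖(Torus.geometry (Fin 3)).sepVec (z i).1 (z k).1‖} := by
      ext z; simp only [Set.mem_setOf_eq, Set.mem_iInter]
    rw [hset]
    exact MeasurableSet.iInter fun k => MeasurableSet.iInter fun _ =>
      measurableSet_lt measurable_const (measurable_sepVec_coord i k).norm
  refine ((hiso i).inter ((hiso j).inter (MeasurableSet.inter ?_ ?_)))
  · exact measurableSet_lt ((measurable_sepVec_coord i j).norm.add
      (measurable_relVel_coord _ i j).norm) measurable_const
  · exact measurableSet_lt ((measurable_sepVec_coord i j).add (measurable_relVel_coord _ i j)).norm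
      measurable_const

/-- The union of witness events is measurable. -/
theorem measurableSet_aimedPairs (σ T R : ℝ) (N : ℕ) : MeasurableSet (AimedPairs σ T R N) :=
  MeasurableSet.biUnion (Set.to_countable _) fun j _ => measurableSet_aimedPair σ T R N 0 j

/-- On the witness event intersected with the good set, some sphere is bad (certification
lemma at `t = Tℓ/2`). -/
theorem one_le_badCount_of_mem_aimedPairs {σ T R : ℝ} {N : ℕ} (hT : 0 ≤ T) (Φ : Flow σ N)
    {Ψ : ClusterFlows σ N} (hΨ : SingletonFree Ψ) {z : Config (N + 1) (Fin 3) T3}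
    (hz : z ∈ AimedPairs σ T R N) (hzg : z ∈ Φ.good) : 1 ≤ badCount σ T R N Φ Ψ z := by
  simp only [AimedPairs, Set.mem_iUnion, Set.mem_setOf_eq, exists_prop] at hz
  obtain ⟨j, hj0, hiso0, hisoj, hchart, hover⟩ := hz
  have hℓ : 0 ≤ T * ell N := mul_nonneg hT (Real.rpow_nonneg (by positivity) _)
  exact one_le_badCount_of_isolated_overlap Φ hΨ hzg (Ne.symm hj0) hiso0 hisoj
    (by positivity) (half_le_self hℓ) hchart hover

/-- The diameter `σℓ` is positive and at most `σ`. -/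
theorem hsDiameter_pos_le {σ : ℝ} (hσ : 0 < σ) (N : ℕ) :
    0 < hsDiameter σ N ∧ hsDiameter σ N ≤ σ := by
  unfold hsDiameter
  have h1 : (1 : ℝ) ≤ ((N + 1 : ℕ) : ℝ) := by exact_mod_cast Nat.succ_le_succ (Nat.zero_le N)
  refine ⟨mul_pos hσ (Real.rpow_pos_of_pos (by positivity) _), ?_⟩
  calc σ * ((N + 1 : ℕ) : ℝ) ^ (-(1 / 3 : ℝ)) ≤ σ * 1 :=
        mul_le_mul_of_nonneg_left (Real.rpow_le_one_of_one_le_of_nonpos h1 (by norm_num)) hσ.le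
    _ = σ := mul_one σ

end Certification

/-! ## (G) ONE static estimate under both load-bearing claims: served spheres

A sphere `i` is SERVED (`Served`) if it is slow (`‖(Tℓ/2)·v_i‖ < (R′ℓ − 2ε)/2`,
`R′ = max R 3σ`), isolated at range `R′ℓ`, and some isolated partner `j` is aimed at it (free
flights `< ε` apart at `Tℓ/2`). Deterministically (certification + a matching argument: slow
isolated spheres cannot be partners and cannot share a partner), `#bad ≥ #served` on the good
set; probabilistically (reverse Markov), `G_N(#served ≥ p(N+1)/2) ≥ p/2` as soon as every
sphere is served with probability `≥ p`. Hence `CorruptionEvent` AND `PositiveBadFraction` (so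
`¬WithoutDelta` and `¬UniformInLam`) follow from the single static estimate `servedSphere_mass`
of §E. -/

section Served

/-- The bad set (the `Finset.filter` of the crux); `badCount` is its cardinality by `rfl`. -/
def badSet (σ T R : ℝ) (N : ℕ) (Φ : Flow σ N) (Ψ : ClusterFlows σ N)
    (z : Config (N + 1) (Fin 3) T3) : Finset (Fin (N + 1)) :=
  Finset.univ.filter fun i : Fin (N + 1) => ∃ t ∈ Set.Icc (0 : ℝ) (T * ell N),
      Φ.flow t z i ≠ localClusterState Ψ (R * ell N) t z i

theorem badCount_eq_card_badSet (σ T R : ℝ) (N : ℕ) (Φ : Flow σ N) (Ψ : ClusterFlows σ N)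
    (z : Config (N + 1) (Fin 3) T3) : badCount σ T R N Φ Ψ z = (badSet σ T R N Φ Ψ z).card := rfl

/-- Membership in the bad set. -/
theorem mem_badSet {σ T R : ℝ} {N : ℕ} {Φ : Flow σ N} {Ψ : ClusterFlows σ N}
    {z : Config (N + 1) (Fin 3) T3} {i : Fin (N + 1)} :
    i ∈ badSet σ T R N Φ Ψ z ↔ ∃ t ∈ Set.Icc (0 : ℝ) (T * ell N),
      Φ.flow t z i ≠ localClusterState Ψ (R * ell N) t z i := by
  simp [badSet]

/-- SHARP CERTIFICATION: two isolated spheres whose free flights overlap inside the window —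
one of THEM is bad. -/
theorem mem_badSet_or_of_isolated_overlap {σ T R : ℝ} {N : ℕ} (Φ : Flow σ N)
    {Ψ : ClusterFlows σ N} (hΨ : SingletonFree Ψ) {z : Config (N + 1) (Fin 3) T3}
    (hz : z ∈ Φ.good) {i j : Fin (N + 1)} (hij : i ≠ j)
    (hi : ∀ k, k ≠ i → R * ell N < ‖(Torus.geometry (Fin 3)).sepVec (z i).1 (z k).1‖)
    (hj : ∀ k, k ≠ j → R * ell N < ‖(Torus.geometry (Fin 3)).sepVec (z j).1 (z k).1‖)
    {t : ℝ} (ht0 : 0 ≤ t) (htT : t ≤ T * ell N)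
    (hchart : ‖(Torus.geometry (Fin 3)).sepVec (z i).1 (z j).1‖ + ‖t • (z i).2 - t • (z j).2‖ < 1 / 2)
    (hoverlap : ‖(Torus.geometry (Fin 3)).sepVec (z i).1 (z j).1 + (t • (z i).2 - t • (z j).2)‖ <
      hsDiameter σ N) :
    i ∈ badSet σ T R N Φ Ψ z ∨ j ∈ badSet σ T R N Φ Ψ z := by
  by_contra hno
  push Not at hno
  obtain ⟨hbi, hbj⟩ := hno
  rw [mem_badSet] at hbi hbj
  push Not at hbi hbj
  have hti := hbi t ⟨ht0, htT⟩
  have htj := hbj t ⟨ht0, htT⟩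
  rw [localClusterState_of_isolated hΨ hi ht0] at hti
  rw [localClusterState_of_isolated hΨ hj ht0] at htj
  have hdom : Φ.flow t z ∈ hardSphereDomain (Torus.geometry (Fin 3)) (N + 1) (hsDiameter σ N) :=
    Φ.good_subset (Φ.mapsTo_good t hz)
  have hsep := hdom i j hij
  rw [hti, htj] at hsep
  dsimp only at hsep
  rw [Torus.sepVec_translate_of_norm_lt hchart] at hsep
  exact (not_lt.2 hsep) hoverlap

/-- TORUS TRIANGLE (vector form): `dist(x, y) ≤ ‖sep(x, z) − sep(y, z)‖`. -/
theorem norm_sepVec_le_norm_sepVec_sub (x y w : T3) :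
    ‖(Torus.geometry (Fin 3)).sepVec x y‖ ≤
      ‖(Torus.geometry (Fin 3)).sepVec x w - (Torus.geometry (Fin 3)).sepVec y w‖ := by
  simp only [Torus.geometry_sepVec]
  have hxy : x - y = 0 + Literature.Analysis.FunctionSpaces.Torus.proj (Torus.reprSym (x - w) - Torus.reprSym (y - w)) := by
    rw [show Literature.Analysis.FunctionSpaces.Torus.proj (Torus.reprSym (x - w) - Torus.reprSym (y - w)) =
        Literature.Analysis.FunctionSpaces.Torus.proj (Torus.reprSym (x - w)) -
          Literature.Analysis.FunctionSpaces.Torus.proj (Torus.reprSym (y - w)) from rfl,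
      Torus.proj_reprSym, Torus.proj_reprSym]
    abel
  rw [hxy]
  simpa using Torus.norm_reprSym_add_proj_le (0 : T3) (Torus.reprSym (x - w) - Torus.reprSym (y - w))

/-- The isolation radius of the witness event: `R′ = max R 3σ` (so that slow spheres exist even
for `R < 2σ`). -/
abbrev capRange (σ R : ℝ) : ℝ := max R (3 * σ)

/-- THE SERVED-PAIR EVENT for `(i, j)`: `i` and `j` isolated at range `R′ℓ`, free flights
`< ε` apart (in the chart) at `t = Tℓ/2`, and `i` SLOW: `‖t·v_i‖ < (R′ℓ − 2ε)/2`. -/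
def CappedAimedPair (σ T R : ℝ) (N : ℕ) (i j : Fin (N + 1)) : Set (Config (N + 1) (Fin 3) T3) :=
  {z | (∀ k, k ≠ i → capRange σ R * ell N < ‖(Torus.geometry (Fin 3)).sepVec (z i).1 (z k).1‖) ∧
    (∀ k, k ≠ j → capRange σ R * ell N < ‖(Torus.geometry (Fin 3)).sepVec (z j).1 (z k).1‖) ∧
    ‖(Torus.geometry (Fin 3)).sepVec (z i).1 (z j).1‖ +
        ‖(T * ell N / 2) • (z i).2 - (T * ell N / 2) • (z j).2‖ < 1 / 2 ∧
    ‖(Torus.geometry (Fin 3)).sepVec (z i).1 (z j).1 +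
        ((T * ell N / 2) • (z i).2 - (T * ell N / 2) • (z j).2)‖ < hsDiameter σ N ∧
    ‖(T * ell N / 2) • (z i).2‖ < (capRange σ R * ell N - 2 * hsDiameter σ N) / 2}

/-- Sphere `i` is SERVED: some `j ≠ i` forms a served pair with it. -/
def Served (σ T R : ℝ) (N : ℕ) (i : Fin (N + 1)) : Set (Config (N + 1) (Fin 3) T3) :=
  ⋃ j ∈ {j : Fin (N + 1) | j ≠ i}, CappedAimedPair σ T R N i j

theorem ell_pos (N : ℕ) : 0 < ell N := Real.rpow_pos_of_pos (by positivity) _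

/-- Isolation at range `R′ℓ` implies isolation at the forecast range `Rℓ`. -/
theorem isolated_of_capRange {σ R : ℝ} {N : ℕ} {z : Config (N + 1) (Fin 3) T3} {i : Fin (N + 1)}
    (h : ∀ k, k ≠ i → capRange σ R * ell N < ‖(Torus.geometry (Fin 3)).sepVec (z i).1 (z k).1‖) :
    ∀ k, k ≠ i → R * ell N < ‖(Torus.geometry (Fin 3)).sepVec (z i).1 (z k).1‖ := fun k hk =>
  lt_of_le_of_lt (mul_le_mul_of_nonneg_right (le_max_left _ _) (ell_pos N).le) (h k hk)

/-- On a served pair (and the good set), `i` or `j` is bad. -/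
theorem mem_badSet_or_of_cappedAimedPair {σ T R : ℝ} {N : ℕ} (hT : 0 ≤ T) (Φ : Flow σ N)
    {Ψ : ClusterFlows σ N} (hΨ : SingletonFree Ψ) {z : Config (N + 1) (Fin 3) T3}
    (hz : z ∈ Φ.good) {i j : Fin (N + 1)} (hij : i ≠ j) (h : z ∈ CappedAimedPair σ T R N i j) :
    i ∈ badSet σ T R N Φ Ψ z ∨ j ∈ badSet σ T R N Φ Ψ z := by
  obtain ⟨hi, hj, hchart, hover, -⟩ := h
  have hℓ : 0 ≤ T * ell N := mul_nonneg hT (ell_pos N).le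
  exact mem_badSet_or_of_isolated_overlap Φ hΨ hz hij (isolated_of_capRange hi)
    (isolated_of_capRange hj) (by positivity) (half_le_self hℓ) hchart hover

/-- NO SHARED PARTNERS: two slow isolated spheres aimed at by the same `j` coincide. -/
theorem eq_of_cappedAimedPair_of_cappedAimedPair {σ T R : ℝ} {N : ℕ}
    {z : Config (N + 1) (Fin 3) T3} {i i' j : Fin (N + 1)}
    (h : z ∈ CappedAimedPair σ T R N i j) (h' : z ∈ CappedAimedPair σ T R N i' j) : i = i' := by
  by_contra hne
  obtain ⟨hi, -, -, hover, hcap⟩ := h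
  obtain ⟨-, -, -, hover', hcap'⟩ := h'
  set G := Torus.geometry (Fin 3)
  set t : ℝ := T * ell N / 2
  have hiso := hi i' (Ne.symm hne)
  -- R'ℓ < ‖sep(x_i, x_i')‖ ≤ ‖sep_ij - sep_i'j‖ ≤ ε + ε + ‖t v_i‖ + ‖t v_i'‖ < R'ℓ
  have htri := norm_sepVec_le_norm_sepVec_sub (z i).1 (z i').1 (z j).1
  have halg : G.sepVec (z i).1 (z j).1 - G.sepVec (z i').1 (z j).1 =
      (G.sepVec (z i).1 (z j).1 + (t • (z i).2 - t • (z j).2)) -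
        (G.sepVec (z i').1 (z j).1 + (t • (z i').2 - t • (z j).2)) - (t • (z i).2 - t • (z i').2) := by
    abel
  have hbound : ‖G.sepVec (z i).1 (z j).1 - G.sepVec (z i').1 (z j).1‖ <
      capRange σ R * ell N := by
    rw [halg]
    calc ‖(G.sepVec (z i).1 (z j).1 + (t • (z i).2 - t • (z j).2)) -
            (G.sepVec (z i').1 (z j).1 + (t • (z i').2 - t • (z j).2)) - (t • (z i).2 - t • (z i').2)‖
        ≤ ‖G.sepVec (z i).1 (z j).1 + (t • (z i).2 - t • (z j).2)‖ +
            ‖G.sepVec (z i').1 (z j).1 + (t • (z i').2 - t • (z j).2)‖ + (‖t • (z i).2‖ + ‖t • (z i').2‖) := by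
          refine (norm_sub_le _ _).trans (add_le_add ((norm_sub_le _ _).trans le_rfl) (norm_sub_le _ _))
      _ < hsDiameter σ N + hsDiameter σ N + ((capRange σ R * ell N - 2 * hsDiameter σ N) / 2 +
            (capRange σ R * ell N - 2 * hsDiameter σ N) / 2) := by
          gcongr
      _ = capRange σ R * ell N := by ring
  exact (lt_irrefl _) ((hiso.trans_le htri).trans hbound)

/-- SLOW ISOLATED SPHERES ARE NEVER PARTNERS: if `i` is in a served pair (as the slow sphere)
then no served pair has `i` as its partner. -/
theorem not_cappedAimedPair_partner {σ T R : ℝ} {N : ℕ} {z : Config (N + 1) (Fin 3) T3}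
    {i j i' : Fin (N + 1)} (hii : i ≠ i') (h : z ∈ CappedAimedPair σ T R N i j)
    (h' : z ∈ CappedAimedPair σ T R N i' i) : False := by
  obtain ⟨-, -, -, -, hcap⟩ := h
  obtain ⟨hi', -, -, hover', hcap'⟩ := h'
  set G := Torus.geometry (Fin 3)
  set t : ℝ := T * ell N / 2
  have hiso := hi' i hii
  have halg : G.sepVec (z i').1 (z i).1 =
      (G.sepVec (z i').1 (z i).1 + (t • (z i').2 - t • (z i).2)) - t • (z i').2 + t • (z i).2 := by abel
  have hbound : ‖G.sepVec (z i').1 (z i).1‖ < capRange σ R * ell N := by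
    rw [halg]
    calc ‖G.sepVec (z i').1 (z i).1 + (t • (z i').2 - t • (z i).2) - t • (z i').2 + t • (z i).2‖
        ≤ ‖G.sepVec (z i').1 (z i).1 + (t • (z i').2 - t • (z i).2)‖ + ‖t • (z i').2‖ + ‖t • (z i).2‖ := by
          refine (norm_add_le _ _).trans (add_le_add ((norm_sub_le _ _).trans le_rfl) le_rfl)
      _ < hsDiameter σ N + (capRange σ R * ell N - 2 * hsDiameter σ N) / 2 +
            (capRange σ R * ell N - 2 * hsDiameter σ N) / 2 := by gcongr
      _ = capRange σ R * ell N - hsDiameter σ N := by ring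
      _ ≤ capRange σ R * ell N := sub_le_self _ (le_of_lt (by
          have := hover'.le; exact lt_of_le_of_lt (norm_nonneg _) hover'))
  exact (lt_irrefl _) (hiso.trans hbound)

end Served

section ServedCount

/-- The set of served spheres. -/
def servedSet (σ T R : ℝ) (N : ℕ) (z : Config (N + 1) (Fin 3) T3) : Finset (Fin (N + 1)) :=
  Finset.univ.filter fun i : Fin (N + 1) => z ∈ Served σ T R N i

theorem mem_servedSet {σ T R : ℝ} {N : ℕ} {z : Config (N + 1) (Fin 3) T3} {i : Fin (N + 1)} :
    i ∈ servedSet σ T R N z ↔ z ∈ Served σ T R N i := by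
  simp [servedSet]

theorem mem_served_iff {σ T R : ℝ} {N : ℕ} {z : Config (N + 1) (Fin 3) T3} {i : Fin (N + 1)} :
    z ∈ Served σ T R N i ↔ ∃ j, j ≠ i ∧ z ∈ CappedAimedPair σ T R N i j := by
  simp only [Served, Set.mem_iUnion, Set.mem_setOf_eq, exists_prop]

/-- **MATCHING LEMMA**: on the good set, `#served ≤ #bad` — pick for each served `i` a partner
`j(i)` and a bad sphere `b(i) ∈ {i, j(i)}` (certification); `b` is injective because slow
isolated spheres are never partners and never share a partner. -/
theorem card_servedSet_le_badCount {σ T R : ℝ} {N : ℕ} (hT : 0 ≤ T) (Φ : Flow σ N)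
    {Ψ : ClusterFlows σ N} (hΨ : SingletonFree Ψ) {z : Config (N + 1) (Fin 3) T3}
    (hz : z ∈ Φ.good) : (servedSet σ T R N z).card ≤ badCount σ T R N Φ Ψ z := by
  classical
  have hpart : ∀ i ∈ servedSet σ T R N z, ∃ j, j ≠ i ∧ z ∈ CappedAimedPair σ T R N i j :=
    fun i hi => mem_served_iff.1 (mem_servedSet.1 hi)
  choose! jp hjp using hpart
  have hbad : ∀ i ∈ servedSet σ T R N z, ∃ b, (b = i ∨ b = jp i) ∧ b ∈ badSet σ T R N Φ Ψ z := by
    intro i hi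
    obtain ⟨hne, hmem⟩ := hjp i hi
    rcases mem_badSet_or_of_cappedAimedPair hT Φ hΨ hz (Ne.symm hne) hmem with h | h
    exacts [⟨i, Or.inl rfl, h⟩, ⟨jp i, Or.inr rfl, h⟩]
  choose! b hb using hbad
  rw [badCount_eq_card_badSet]
  refine Finset.card_le_card_of_injOn b (fun i hi => (hb i hi).2) ?_
  intro i hi i' hi' hEq
  rw [Finset.mem_coe] at hi hi'
  obtain ⟨hbi, -⟩ := hb i hi
  obtain ⟨hbi', -⟩ := hb i' hi'
  obtain ⟨hne, hmem⟩ := hjp i hi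
  obtain ⟨hne', hmem'⟩ := hjp i' hi'
  rcases hbi with h1 | h1 <;> rcases hbi' with h2 | h2
  · calc i = b i := h1.symm
      _ = b i' := hEq
      _ = i' := h2
  · exfalso
    have hji : jp i' = i := by rw [← h2, ← hEq, h1]
    rw [hji] at hmem' hne'
    exact not_cappedAimedPair_partner hne' hmem hmem'
  · exfalso
    have hji : jp i = i' := by rw [← h1, hEq, h2]
    rw [hji] at hmem hne
    exact not_cappedAimedPair_partner hne hmem' hmem
  · have hjj : jp i = jp i' := by rw [← h1, hEq, h2]
    rw [hjj] at hmem
    exact eq_of_cappedAimedPair_of_cappedAimedPair hmem hmem'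

/-- The served-pair event is measurable. -/
theorem measurableSet_cappedAimedPair (σ T R : ℝ) (N : ℕ) (i j : Fin (N + 1)) :
    MeasurableSet (CappedAimedPair σ T R N i j) := by
  have hiso : ∀ i : Fin (N + 1), MeasurableSet {z : Config (N + 1) (Fin 3) T3 |
      ∀ k, k ≠ i → capRange σ R * ell N < ‖(Torus.geometry (Fin 3)).sepVec (z i).1 (z k).1‖} := by
    intro i
    have hset : {z : Config (N + 1) (Fin 3) T3 |
        ∀ k, k ≠ i → capRange σ R * ell N < ‖(Torus.geometry (Fin 3)).sepVec (z i).1 (z k).1‖} =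
        ⋂ (k : Fin (N + 1)) (_ : k ≠ i),
          {z | capRange σ R * ell N < ‖(Torus.geometry (Fin 3)).sepVec (z i).1 (z k).1‖} := by
      ext z; simp only [Set.mem_setOf_eq, Set.mem_iInter]
    rw [hset]
    exact MeasurableSet.iInter fun k => MeasurableSet.iInter fun _ =>
      measurableSet_lt measurable_const (measurable_sepVec_coord i k).norm
  refine (hiso i).inter ((hiso j).inter (MeasurableSet.inter ?_ (MeasurableSet.inter ?_ ?_)))
  · exact measurableSet_lt ((measurable_sepVec_coord i j).norm.add
      (measurable_relVel_coord _ i j).norm) measurable_const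
  · exact measurableSet_lt ((measurable_sepVec_coord i j).add (measurable_relVel_coord _ i j)).norm
      measurable_const
  · have hv : Measurable fun z : Config (N + 1) (Fin 3) T3 => (T * ell N / 2) • (z i).2 :=
      ((measurable_pi_apply i : Measurable fun z : Config (N + 1) (Fin 3) T3 => z i).snd).const_smul
        (T * ell N / 2)
    exact measurableSet_lt hv.norm measurable_const

/-- `Served i` is measurable. -/
theorem measurableSet_served (σ T R : ℝ) (N : ℕ) (i : Fin (N + 1)) :
    MeasurableSet (Served σ T R N i) :=
  MeasurableSet.biUnion (Set.to_countable _) fun j _ => measurableSet_cappedAimedPair σ T R N i j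

/-- The served count as a sum of indicators (for integration). -/
theorem sum_indicator_served_eq_card {σ T R : ℝ} {N : ℕ} (z : Config (N + 1) (Fin 3) T3) :
    (∑ i : Fin (N + 1), (Served σ T R N i).indicator (fun _ => (1 : ℝ≥0∞)) z) =
      ((servedSet σ T R N z).card : ℝ≥0∞) := by
  classical
  simp only [Set.indicator_apply, servedSet]
  rw [Finset.sum_boole]

/-- **REVERSE MARKOV** for a sum of indicators: if each of the `n ≥ 1` events has
probability `≥ p`, then with probability `≥ p/2` at least `(p/2)·n` of them occur. -/
theorem measure_sum_indicator_ge {Ω ι : Type*} [MeasurableSpace Ω] [Fintype ι] [Nonempty ι]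
    (μ : Measure Ω) [IsProbabilityMeasure μ] {S : ι → Set Ω} (hS : ∀ i, MeasurableSet (S i))
    {p : ℝ≥0∞} (hp : ∀ i, p ≤ μ (S i)) :
    p / 2 ≤ μ {ω | p / 2 * (Fintype.card ι : ℝ≥0∞) ≤ ∑ i, (S i).indicator (fun _ => (1 : ℝ≥0∞)) ω} := by
  classical
  obtain ⟨i₀⟩ := ‹Nonempty ι›
  set n : ℝ≥0∞ := (Fintype.card ι : ℝ≥0∞) with hn
  set f : Ω → ℝ≥0∞ := fun ω => ∑ i, (S i).indicator (fun _ => (1 : ℝ≥0∞)) ω with hf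
  have hp1 : p ≤ 1 := (hp i₀).trans prob_le_one
  have hptop : p ≠ ∞ := ne_top_of_le_ne_top ENNReal.one_ne_top hp1
  have hn0 : n ≠ 0 := by
    rw [hn, Nat.cast_ne_zero]
    exact Fintype.card_ne_zero
  have hntop : n ≠ ∞ := ENNReal.natCast_ne_top _
  have hEm : MeasurableSet {ω | p / 2 * n ≤ f ω} :=
    measurableSet_le measurable_const (Finset.measurable_sum _ fun i _ => measurable_const.indicator (hS i))
  -- lower bound on the mean
  have hlow : n * p ≤ ∫⁻ ω, f ω ∂μ := by
    calc n * p = ∑ _i : ι, p := by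
          rw [Finset.sum_const, Finset.card_univ, nsmul_eq_mul]
      _ ≤ ∑ i, μ (S i) := Finset.sum_le_sum fun i _ => hp i
      _ = ∑ i, ∫⁻ ω, (S i).indicator (fun _ => (1 : ℝ≥0∞)) ω ∂μ := by
          refine Finset.sum_congr rfl fun i _ => ?_
          rw [lintegral_indicator_const (hS i), one_mul]
      _ = ∫⁻ ω, f ω ∂μ := (lintegral_finsetSum _ fun i _ => measurable_const.indicator (hS i)).symm
  -- upper bound on the mean
  have hup : ∫⁻ ω, f ω ∂μ ≤ p / 2 * n + n * μ {ω | p / 2 * n ≤ f ω} := by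
    have hpt : ∀ ω, f ω ≤ p / 2 * n + n * {ω | p / 2 * n ≤ f ω}.indicator (fun _ => (1 : ℝ≥0∞)) ω := by
      intro ω
      by_cases hω : p / 2 * n ≤ f ω
      · have hmem : ω ∈ {ω | p / 2 * n ≤ f ω} := hω
        have hfle : f ω ≤ n := by
          calc f ω = ∑ i, (S i).indicator (fun _ => (1 : ℝ≥0∞)) ω := rfl
            _ ≤ ∑ _i : ι, (1 : ℝ≥0∞) := Finset.sum_le_sum fun i _ =>
                Set.indicator_apply_le' (fun _ => le_rfl) (fun _ => zero_le_one)
            _ = n := by rw [Finset.sum_const, Finset.card_univ, nsmul_eq_mul, mul_one]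
        rw [Set.indicator_of_mem hmem, mul_one]
        exact hfle.trans le_add_self
      · have hnot : ω ∉ {ω | p / 2 * n ≤ f ω} := hω
        rw [Set.indicator_of_notMem hnot, mul_zero, add_zero]
        exact (not_le.1 hω).le
    calc ∫⁻ ω, f ω ∂μ ≤ ∫⁻ ω, (p / 2 * n + n * {ω | p / 2 * n ≤ f ω}.indicator (fun _ => (1 : ℝ≥0∞)) ω) ∂μ :=
          lintegral_mono hpt
      _ = p / 2 * n + n * μ {ω | p / 2 * n ≤ f ω} := by
          rw [lintegral_add_left measurable_const, lintegral_const, measure_univ, mul_one,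
            lintegral_const_mul _ (measurable_const.indicator hEm), lintegral_indicator_const hEm,
            one_mul]
  -- combine
  have hsplit : n * p = p / 2 * n + p / 2 * n := by
    rw [← add_mul, ENNReal.add_halves, mul_comm]
  have key : p / 2 * n + p / 2 * n ≤ p / 2 * n + n * μ {ω | p / 2 * n ≤ f ω} :=
    hsplit ▸ hlow.trans hup
  have hfin : p / 2 * n ≠ ∞ := ENNReal.mul_ne_top (ENNReal.div_ne_top hptop two_ne_zero) hntop
  have key2 : p / 2 * n ≤ n * μ {ω | p / 2 * n ≤ f ω} := (ENNReal.add_le_add_iff_left hfin).1 key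
  have key3 : n * (p / 2) ≤ n * μ {ω | p / 2 * n ≤ f ω} :=
    calc n * (p / 2) = p / 2 * n := mul_comm _ _
      _ ≤ _ := key2
  exact (ENNReal.mul_le_mul_iff_right hn0 hntop).1 key3

end ServedCount

section Reductions

/-- DYNAMICAL INPUT 2′ (weaker than `TypicalBadFraction`, and all the kill needs): at fixed
`(σ, T, R)`, a bad FRACTION `ε` occurs with probability `≥ q > 0`, uniformly in `N`. -/
def PositiveBadFraction (a θ : ℝ) (u₀ : V3) (σ T R : ℝ) : Prop :=
  ∃ ε : ℝ, 0 < ε ∧ ∃ q : ℝ, 0 < q ∧ ∃ N₀ : ℕ, ∀ N : ℕ, N₀ ≤ N → ∃ (Φ : Flow σ N)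
    (Ψ : ClusterFlows σ N) (A : Set (Config (N + 1) (Fin 3) T3)) (m : ℕ), MeasurableSet A ∧
    ε * (N + 1) ≤ m ∧ (∀ z ∈ A, m ≤ badCount σ T R N Φ Ψ z) ∧
    ENNReal.ofReal q ≤ gibbs σ a θ u₀ N Φ A

/-- THE ORDER `lam` BEFORE `R` IS LOAD-BEARING, sharp form: a positive-probability bad fraction
at every range kills `UniformInLam` (Chebyshev at `lam = 2/ε`: `G_N(A) ≤ e^{-(N+1)} < q`). -/
theorem uniformInLam_false_of_positiveBadFraction
    (h : ∀ σ₀ : ℝ, 0 < σ₀ → ∃ σ : ℝ, 0 < σ ∧ σ < σ₀ ∧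
      ∀ R : ℝ, 0 < R → PositiveBadFraction 1 1 0 σ 1 R) :
    ¬ UniformInLam := by
  intro hU
  obtain ⟨σ₀, hσ₀, hσ⟩ := hU 1 1 0 one_pos one_pos
  obtain ⟨σ, hs, hs', hR⟩ := h σ₀ hσ₀
  obtain ⟨R, hRpos, hl⟩ := hσ σ hs hs' 1 1 one_pos one_pos
  obtain ⟨ε, hε, q, hq, N₁, hN₁⟩ := hR R hRpos
  obtain ⟨N₀, hN⟩ := hl (2 / ε) (by positivity)
  obtain ⟨N₂, hN₂⟩ := exists_nat_gt (1 / q)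
  set M : ℕ := max (max N₀ N₁) N₂ with hM
  obtain ⟨Φ, Ψ, A, m, hA, hεm, hbad, hqA⟩ :=
    hN₁ M ((le_max_right _ _).trans (le_max_left _ _))
  have hB := hN M ((le_max_left _ _).trans (le_max_left _ _)) Φ Ψ
  have hcheb := measure_le_of_bound hB (by positivity) hA hbad
  have hexp : (1 : ℝ) * ((M : ℝ) + 1) - 2 / ε * m ≤ -((M : ℝ) + 1) := by
    have h4 : 2 / ε * (ε * ((M : ℝ) + 1)) ≤ 2 / ε * m := mul_le_mul_of_nonneg_left hεm (by positivity)
    have h4' : 2 / ε * (ε * ((M : ℝ) + 1)) = 2 * ((M : ℝ) + 1) := by field_simp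
    linarith
  have hsmall : Real.exp (-((M : ℝ) + 1)) < q := by
    have h1 : Real.exp (-((M : ℝ) + 1)) ≤ 1 / ((M : ℝ) + 2) := by
      rw [Real.exp_neg, ← one_div]
      apply one_div_le_one_div_of_le (by positivity)
      have := Real.add_one_le_exp ((M : ℝ) + 1)
      linarith
    have h2 : 1 / ((M : ℝ) + 2) < q := by
      rw [one_div_lt (by positivity) hq]
      calc 1 / q < N₂ := hN₂
        _ ≤ M := by exact_mod_cast le_max_right _ _
        _ < M + 2 := by linarith
    exact h1.trans_lt h2
  have hlt : gibbs σ 1 1 0 M Φ A < ENNReal.ofReal q :=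
    calc gibbs σ 1 1 0 M Φ A ≤ ENNReal.ofReal (Real.exp ((1 : ℝ) * ((M : ℝ) + 1) - 2 / ε * m)) := hcheb
      _ ≤ ENNReal.ofReal (Real.exp (-((M : ℝ) + 1))) :=
          ENNReal.ofReal_le_ofReal (Real.exp_le_exp.2 hexp)
      _ < ENNReal.ofReal q := (ENNReal.ofReal_lt_ofReal_iff hq).2 hsmall
  exact (not_lt.2 hqA) hlt

/-- THE SINGLE STATIC INPUT: every sphere is served with probability `≥ p > 0`, uniformly in
`N ≥ N₀` (an equilibrium statement about the dilute hard-sphere Gibbs state; §E). -/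
def ServedSphereMass (σ T R : ℝ) : Prop :=
  ∃ p : ℝ, 0 < p ∧ ∃ N₀ : ℕ, ∀ N : ℕ, N₀ ≤ N → ∀ (Φ : Flow σ N) (i : Fin (N + 1)),
    ENNReal.ofReal p ≤ gibbs σ 1 1 0 N Φ (Served σ T R N i)

/-- `ServedSphereMass ⇒ CorruptionEvent` (sphere `0` served ⇒ a bad sphere, on the good set). -/
theorem corruptionEvent_of_servedSphereMass {σ T R : ℝ} (hσ : 0 < σ) (hσ' : σ ≤ 1 / 4)
    (hT : 0 < T) (h : ServedSphereMass σ T R) : CorruptionEvent 1 1 0 σ T R := by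
  obtain ⟨p, hp, N₀, hN⟩ := h
  refine ⟨ENNReal.ofReal p, ENNReal.ofReal_pos.2 hp, N₀, fun N hN₀ => ?_⟩
  obtain ⟨hε, hεσ⟩ := hsDiameter_pos_le hσ N
  have hε' : hsDiameter σ N < 2⁻¹ := hεσ.trans_lt (hσ'.trans_lt (by norm_num))
  refine ⟨alexanderFlow hε hε' (N + 1), fun k => alexanderFlow hε hε' k,
    Served σ T R N 0 ∩ (alexanderFlow hε hε' (N + 1)).good,
    (measurableSet_served σ T R N 0).inter (alexanderFlow hε hε' (N + 1)).measurableSet_good, ?_, ?_⟩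
  · rintro z ⟨hz, hzg⟩
    obtain ⟨j, hj0, hmem⟩ := mem_served_iff.1 hz
    rw [badCount_eq_card_badSet, Nat.one_le_iff_ne_zero, Ne, Finset.card_eq_zero,
      ← Ne, ← Finset.nonempty_iff_ne_empty]
    rcases mem_badSet_or_of_cappedAimedPair hT.le _ (singletonFree_alexander hε hε') hzg
      (Ne.symm hj0) hmem with h | h
    exacts [⟨0, h⟩, ⟨j, h⟩]
  · rw [measure_inter_conull (gibbs_compl_good σ 1 1 0 N _)]
    exact hN N hN₀ _ 0

/-- `ServedSphereMass ⇒ PositiveBadFraction` (matching lemma + reverse Markov), with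
`ε = q = p/2`. -/
theorem positiveBadFraction_of_servedSphereMass {σ T R : ℝ} (hσ : 0 < σ) (hσ' : σ ≤ 1 / 4)
    (hT : 0 < T) (h : ServedSphereMass σ T R) : PositiveBadFraction 1 1 0 σ T R := by
  obtain ⟨p, hp, N₀, hN⟩ := h
  refine ⟨p / 2, by positivity, p / 2, by positivity, N₀, fun N hN₀ => ?_⟩
  obtain ⟨hε, hεσ⟩ := hsDiameter_pos_le hσ N
  have hε' : hsDiameter σ N < 2⁻¹ := hεσ.trans_lt (hσ'.trans_lt (by norm_num))
  haveI : IsProbabilityMeasure (gibbs σ 1 1 0 N (alexanderFlow hε hε' (N + 1))) :=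
    isProbabilityMeasure_gibbs 0 one_pos one_pos (hσ'.trans (by norm_num)) N _
  have hEm : MeasurableSet {z : Config (N + 1) (Fin 3) T3 |
      ENNReal.ofReal p / 2 * (Fintype.card (Fin (N + 1)) : ℝ≥0∞) ≤
        ∑ i, (Served σ T R N i).indicator (fun _ => (1 : ℝ≥0∞)) z} :=
    measurableSet_le measurable_const
      (Finset.measurable_sum _ fun i _ => measurable_const.indicator (measurableSet_served σ T R N i))
  have hmass := measure_sum_indicator_ge (gibbs σ 1 1 0 N (alexanderFlow hε hε' (N + 1)))
    (fun i => measurableSet_served σ T R N i) (fun i => hN N hN₀ (alexanderFlow hε hε' (N + 1)) i)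
  refine ⟨alexanderFlow hε hε' (N + 1), fun k => alexanderFlow hε hε' k,
    {z : Config (N + 1) (Fin 3) T3 | ENNReal.ofReal p / 2 * (Fintype.card (Fin (N + 1)) : ℝ≥0∞) ≤
        ∑ i, (Served σ T R N i).indicator (fun _ => (1 : ℝ≥0∞)) z} ∩ (alexanderFlow hε hε' (N + 1)).good,
    ⌈p / 2 * ((N : ℝ) + 1)⌉₊, hEm.inter (alexanderFlow hε hε' (N + 1)).measurableSet_good,
    Nat.le_ceil _, ?_, ?_⟩
  · rintro z ⟨hzE, hzg⟩
    have h2 : ENNReal.ofReal p / 2 * (Fintype.card (Fin (N + 1)) : ℝ≥0∞) =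
        ENNReal.ofReal (p / 2 * ((N : ℝ) + 1)) := by
      rw [Fintype.card_fin, ENNReal.ofReal_mul (by positivity : (0 : ℝ) ≤ p / 2),
        ENNReal.ofReal_div_of_pos two_pos, ENNReal.ofReal_ofNat]
      congr 1
      push_cast
      rw [ENNReal.ofReal_add (by positivity) zero_le_one, ENNReal.ofReal_natCast, ENNReal.ofReal_one]
    have h1 : ENNReal.ofReal (p / 2 * ((N : ℝ) + 1)) ≤ ((servedSet σ T R N z).card : ℝ≥0∞) := by
      rw [← h2, ← sum_indicator_served_eq_card]
      exact hzE
    have h3 : ((servedSet σ T R N z).card : ℝ≥0∞) =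
        ENNReal.ofReal ((servedSet σ T R N z).card : ℝ) := by rw [ENNReal.ofReal_natCast]
    rw [h3, ENNReal.ofReal_le_ofReal_iff (Nat.cast_nonneg _)] at h1
    calc ⌈p / 2 * ((N : ℝ) + 1)⌉₊ ≤ (servedSet σ T R N z).card := Nat.ceil_le.2 h1
      _ ≤ _ := card_servedSet_le_badCount hT.le _ (singletonFree_alexander hε hε') hzg
  · rw [measure_inter_conull (gibbs_compl_good σ 1 1 0 N _), ENNReal.ofReal_div_of_pos two_pos,
      ENNReal.ofReal_ofNat]
    exact hmass

end Reductions





/-! ## (E) The near-miss: ONE static equilibrium estimate (the only `sorry` of this file)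

Everything dynamical is discharged (§F certification, §G matching + reverse Markov). What is
left is a statement about the canonical Gibbs law of dilute hard spheres at EQUAL TIMES. -/

/-- NEAR-MISS (static). Every sphere `i` is SERVED with `G_N`-probability `≥ p(σ,T,R) > 0`,
uniformly in `N ≥ N₀`: `i` slow (`‖(Tℓ/2)v_i‖ < (R′ℓ − 2ε)/2`, `R′ = max R 3σ`), nobody within
`R′ℓ` of `x_i`, and some `j` isolated at `R′ℓ` with `‖sep(x_i,x_j) + (Tℓ/2)(v_i − v_j)‖ < ε`
(plus the chart bound). PLAN: restrict to the sub-event "x_j in the shell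
`R′ℓ + 2ε < ‖sep‖ < R′ℓ + 3ε`, nobody else within `R′ℓ + 3ε` of `x_i`"; disintegrate `G_N`
(tree: `lintegral_localGibbsMeasure`, `velMeasure = Measure.pi gaussMeasure`): the velocity
section has `γ ⊗ γ`-mass `≥ c_vel(σ,T,R) > 0` (two Gaussian balls: `v_i ∈ ball(0, ε/(4t*))`,
`v_j ∈ ball(sep/t*, ε/(4t*))`, `‖sep‖/t* ≤ 2(R′+3σ)/T`, `ε/t* = 2σ/T`, all `N`-free; the cap
`(R′ℓ−2ε)/2 ≥ σℓ/2 > ε/4` holds since `R′ ≥ 3σ`); the position event has `G_N^{pos}`-mass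
`≥ Σ_j V⁻¹|shell|·P(cavity C empty | i, j placed) ≥ |shell|_ℓ · exp(−(N−1)|C|/V_free)/2`
by the INSERTION/CAVITY BOUND (`Z(k in C) ≤ C(n,k)|C|^k Z_{n−k}(Λ∖C)`,
`Z_n(Λ∖C) ≥ Z_{n−k}(Λ∖C)·V_free^k`, sum over `k`; `|C| = O((R′+4σ)³/(N+1))`,
`V_free ≥ 1 − |C| − 8σ³`). NEEDS in Lean: Fubini on `Config (N+1)` separating the velocities of
`i, j` (pi-measure marginals); Gaussian ball lower bound from the `gaussMeasure` density;
exchangeability-free sum over `j`; the insertion bound (new, ~400 lines; template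
`Literature/Barriers/AtomisticToContinuum/HardDiskRuelleEstimate.lean`); volume of small balls in
`T³`. Estimated 1–1.5 kLoC of equilibrium statistical mechanics. -/
theorem servedSphere_mass {σ T R : ℝ} (hσ : 0 < σ) (hσ' : σ ≤ 1 / 4) (hT : 0 < T) (hR : 0 < R) :
    ServedSphereMass σ T R := by
  sorry

/-- `CorruptionEvent` holds (sorry-tainted only through `servedSphere_mass`). -/
theorem corruptionEvent_holds {σ T R : ℝ} (hσ : 0 < σ) (hσ' : σ ≤ 1 / 4) (hT : 0 < T)
    (hR : 0 < R) : CorruptionEvent 1 1 0 σ T R :=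
  corruptionEvent_of_servedSphereMass hσ hσ' hT (servedSphere_mass hσ hσ' hT hR)

/-- `PositiveBadFraction` holds (sorry-tainted only through `servedSphere_mass`). -/
theorem positiveBadFraction_holds {σ T R : ℝ} (hσ : 0 < σ) (hσ' : σ ≤ 1 / 4) (hT : 0 < T)
    (hR : 0 < R) : PositiveBadFraction 1 1 0 σ T R :=
  positiveBadFraction_of_servedSphereMass hσ hσ' hT (servedSphere_mass hσ hσ' hT hR)

/-- COROLLARY: the no-slack strengthening (`δ = 0`) is false. -/
theorem not_withoutDelta : ¬ WithoutDelta :=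
  withoutDelta_false_of_corruption fun σ₀ hσ₀ =>
    ⟨min (σ₀ / 2) (1 / 4), by positivity, (min_le_left _ _).trans_lt (by linarith),
      (min_le_right _ _).trans (by norm_num), fun R hR =>
      corruptionEvent_holds (by positivity) (min_le_right _ _) one_pos hR⟩

/-- COROLLARY: the range-before-rate strengthening (`∃ R ∀ lam`) is false. -/
theorem not_uniformInLam : ¬ UniformInLam :=
  uniformInLam_false_of_positiveBadFraction fun σ₀ hσ₀ =>
    ⟨min (σ₀ / 2) (1 / 4), by positivity, (min_le_left _ _).trans_lt (by linarith),
      fun R hR => positiveBadFraction_holds (by positivity) (min_le_right _ _) one_pos hR⟩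

-- Targets: none this cycle (payload.targets = [], no line picked, no stuck stubs).

end

end Summit.AtomisticToContinuum.HydrodynamicLimit.Cruxes.InfluenceLocality.Disproof
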